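import Literature.MathematicalPhysics.MHD.ScrewPinchEquilibrium
import Literature.MathematicalPhysics.MHD.RFPModelEquilibrium
import HarnessLib

/-!
# The first toroidal correction to a screw pinch: shifted circular flux surfaces, the Shafranov shift,
# the internal inductance `l_i`, and Shafranov's vertical field `B_V = (μ₀I/4πR₀)(β_p + (l_i − 3)/2 + ln 8R₀/a)`
# (Freidberg, *Ideal MHD* (2014) §6.4.2–§6.4.6)

Topic `Literature/MathematicalPhysics/MHD` (namespace = path; sub-namespace `ScrewPinch.Profile`: the zeroth
order of the large-aspect-ratio expansion IS a screw pinch, so the tree's `Profile` (`B_θ, B_z, p, μ₀`), its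
cross-section average `areaAvg` and poloidal beta `rfpBetaP = 2μ₀⟨p⟩/B_θa²` are used BY NAME).  Written for
the venture ladder GRIDFUSION (fusion rungs F1/F2: certified equilibrium data of analytic MODELS) as the
cell's first TOROIDAL-CORRECTION object.  THREE-COLUMN DISCIPLINE: everything here is about a MODEL — the
`ε = a/R₀ ≪ 1`, `β_p ∼ 1` expansion of the Grad–Shafranov equation to first order (Freidberg (6.54)–(6.59)),
in which the flux surfaces are shifted circles; nothing is a statement about a device.

## The model, as printed (read on the page: galaxy:panama:388488381857833 p0119–p0128)
* (6.65) the first-order equation `d/dr[r B_θ² d/dr(ψ̄₁/B_θ)] = r B_θ² − 2μ₀ r² dp/dr` for the `cos θ`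
  amplitude `ψ̄₁` of the flux perturbation (6.64); (6.66) its first integral
  `d/dr(ψ̄₁/B_θ) = (1/(r B_θ²)) ∫_{r₁}^r [y B_θ² − 2μ₀ y² p′] dy`, regularity at the axis forcing `r₁ = 0`;
  (6.67)/(6.73)/(6.77) `ψ̄₁(r) = B_θ(r) ∫_{r₂}^r dx/(x B_θ²(x)) ∫_0^x [y B_θ² − 2μ₀ y² p′] dy` with `r₂ = a`
  (last surface centred: `ψ̄₁(a) = 0`, «`Δ_a = 0`» (6.76));
* (6.72) the SHIFT of the surface of radius `r₀`: `Δ(r₀) = −ψ̄₁(r₀)/(R₀ B_θ(r₀))`, «The shift is outward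
  since `ψ̄₁ < 0`»;
* (6.83) `−∫_0^a 2μ₀ y² p′ dy = 4μ₀ ∫_0^a p y dy = a² B_θa² β_p`; (6.86) `l_i = (2/(a² B_θa²)) ∫_0^a B_θ² y dy`;
  (6.87) `∫_0^x [y B_θ² − 2μ₀ y² p′] dy = a² B_θa² (β_p + l_i/2 + ln x/a)` for `x > a` (vacuum outside:
  `B_θ = B_θa a/x`, `p = 0`); (6.88) `ψ̄₁(r) = (μ₀I/4πr)[(β_p + l_i/2 − 1/2)(r² − a²) + r² ln r/a]`;
  (6.82) the far field `ψ̄₁ → −(μ₀I/4π)(ln 8R₀/r − 1) r + R₀ B_V r` of wire + vertical field; (6.89)–(6.90)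
  matching ⇒ `B_V = (μ₀I/4πR₀)(β_p + (l_i − 3)/2 + ln 8R₀/a)` «first derived by Shafranov (1966)»;
* §5.5.3 (RFP model, chars 276500–284600 of the same scan): (5.42) `p = p_max(1 − ρ⁶)³`, (5.43)
  `⟨p⟩ = (81/140)p_max`, (5.44) `B_z/B_z0 = 1 − 2α_zρ² + α_zρ⁴`, (5.46)–(5.47) the `B_θ²` profile, repeated as
  (6.74); (6.73) the conducting-wall solution and (6.75) `Δ₀/a = (a/R₀)∫₀¹ dx x³g/(B_θ²/B_z0²)` [p0122–p0123].

## Contents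
* §1 DEFINITIONS (bodies, as printed): `torBracket` (the square bracket of (6.66) with `r₁ = 0`),
  `psiBar1` ((6.77), `r₂ = a`), `fluxShift` (6.72), `internalInductance` (6.86),
  `shafranovVerticalField` (6.90), `psiBar1Far` (6.82).
* §2 PROVED, interior (no assumption outside the plasma): `hasDerivAt_torBracket`; ★ `hasDerivAt_psiBar1_div`
  ((6.66): `ψ̄₁` solves the first integral) and `psiBar1_secondOrder` ((6.65) itself); `psiBar1_self`,
  `fluxShift_edge` (`Δ(a) = 0`); `fluxShift_eq_integral` (`Δ(r) = (1/R₀)∫_r^a bracket/(xB_θ²)`);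
  `torBracket_pos` and ★ `fluxShift_pos` («the shift is outward») for `p′ ≤ 0`; ★ `torBracket_edge`
  ((6.83) + (6.86): `bracket(a) = a²B_θa²(β_p + l_i/2)`) and ★ `hasDerivAt_fluxShift` /
  `deriv_fluxShift_edge` (`Δ′(a) = −(a/R₀)(β_p + l_i/2)`, the edge slope of the shift).
* §2b (appended) THE SAME WITH HYPOTHESES ON `[0, a]` ONLY (a model given by formulas valid up to the plasma edge):
  `continuousOn_torBracket_Icc`, `hasDerivAt_torBracket_of_mem_Ioo`, `continuousOn_torBracket_div_Ioc`,
  `torBracket_pos_of_Icc`, ★ `fluxShift_pos_of_Icc` (outward shift), `hasDerivAt_psiBar1_div_of_mem_Ioo`,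
  `hasDerivAt_fluxShift_of_mem_Ioo`, ★ `hasDerivWithinAt_fluxShift_edge` (`Δ′(a⁻) = −(a/R₀)(β_p + l_i/2)` as a
  LEFT derivative within `Iic a`).
* §3 PROVED, with the vacuum region (`B_θ = B_θa a/r`, `p′ = 0` for `r > a`): ★ `torBracket_outer` (6.87),
  ★ `psiBar1_outer` (6.88), and ★ `tendsto_psiBar1_matching` / `psiBar1_matches_iff` ((6.89) = (6.82) in the
  limit `r → ∞` IFF `B_V` is Shafranov's (6.90)).
* §4 WORKED CHECK (non-vacuity): uniform current `B_θ = c r`, flat pressure — `bracket = c²x⁴/4`,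
  `l_i = 1/2`, `Δ(r) = (a² − r²)/(8R₀)`.
* §5 (appended) FREIDBERG'S RFP MODEL PROFILES (5.42)–(5.47) = (6.74) BY NAME on `RFPModelEquilibrium.lean`
  (`RFP.presN`, `RFP.dpresN`, `RFP.bθSqN`, the physical `RFP.profile μ₀ B_z0 a α_p α_z`, its `profile_Bθ_sq`,
  `hasDerivAt_profile_p`, `bθSqN_nonneg/pos/one`): the bracket in closed form `a²B_z0² G(x/a)` (`rfpBracketHat`,
  ★ `torBracket_rfpProfile`, «the y integration can be carried out analytically»), the axis-shift integrand of
  (6.75) `bracket/(xB_θ²) = a (x/a)³ g/(B_θ²/B_z0²)` (`rfpAxisShiftG`, ★ `axisShiftIntegrand_rfpProfile`) and the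
  shift as the printed quadrature ★ `fluxShift_rfpProfile` (`Δ(r) = (a/R₀)∫_r^a (x/a)³g/(B_θ²/B_z0²) dx` on the
  operating range `0 ≤ α_p`, `0 < α_z ≤ 10/7`, `B_θa² > 0`), its REGULAR form `fluxShift_rfpProfile'`
  (`x³g/(B_θ²/B_z0²) = x·g/bθSlopeSq`, BY NAME on `RFP.bθSlopeSq`, continuous on `[0, a]`) and the AXIS SHIFT
  ★ `tendsto_fluxShift_rfpProfile_axis`: `Δ(r) → Δ₀ = (a/R₀)∫_0^a (x/a)g/bθSlopeSq dx` as `r → 0⁺` — Freidberg's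
  `Δ₀/a` of (6.75), the curve of Fig. 6.6 (its certified values are a producer's quadrature); and ON THE MODEL:
  `integral_mul_rfp_bθSqN` (`∫₀¹ρB_θ²/B_z0² = 69α_p/280 + α_z(5/18 − 269α_z/1800)`), ★ `internalInductance_rfpProfile`
  (`l_i` in closed form), ★ `hasDerivWithinAt_fluxShift_edge_rfpProfile` (`Δ′(a⁻) = −(a/R₀)(β_p + l_i/2)`),
  ★ `fluxShift_pos_rfpProfile` (outward shift) — all on the printed operating range, no profile hypotheses.  TRANSCRIPTION NOTE (docstring of `rfpAxisShiftG`): the `α_p`-part of `g` DERIVED here from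
  (6.73)–(6.74) is `α_p(35x⁴/8 − 100x¹⁰/21 + 49x¹⁶/30)`; our OCR of the printed (6.75) reads
  «`(α_p/3)(109x⁴ − 200x¹⁰ + 98x¹⁶)`» — to be checked against the page; the `α_z`-part agrees verbatim.

## Deliberately NOT here
The derivation of (6.63)/(6.65) from the Grad–Shafranov equation (the `ε`-expansion itself is the MODEL);
the wire field (6.78)–(6.81) (elliptic-integral asymptotics); the numerical curve of Fig. 6.6 (a certified
quadrature of `fluxShift_rfpProfile` is a producer's object); the hoop-force form (6.91); non-circular or
finite-`ε` corrections; any device.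
-/

noncomputable section

open Real Set MeasureTheory intervalIntegral Filter Topology

namespace Literature.MathematicalPhysics.MHD

namespace ScrewPinch.Profile

variable (P : Profile)

/-- Interval integrals of functions agreeing on the open interval coincide. [folklore] -/
private lemma intervalIntegral_congr_Ioo' {φ ψ : ℝ → ℝ} {c d : ℝ} (hcd : c ≤ d)
    (h : EqOn φ ψ (Ioo c d)) : ∫ x in c..d, φ x = ∫ x in c..d, ψ x := by
  rw [intervalIntegral.integral_of_le hcd, intervalIntegral.integral_of_le hcd,
    integral_Ioc_eq_integral_Ioo, integral_Ioc_eq_integral_Ioo]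
  exact setIntegral_congr_fun measurableSet_Ioo h

/-! ## §1 Definitions (Freidberg §6.4.4–§6.4.6) -/

/-- THE SQUARE BRACKET of (6.66)/(6.67) with the regular choice `r₁ = 0`:
`∫_0^x [y B_θ²(y) − 2μ₀ y² p′(y)] dy` (the source of the toroidal shift: poloidal-field energy and the
tire-tube force). [cite: Freidberg2014, §6.4.4 eq. (6.66)] -/
def torBracket (x : ℝ) : ℝ :=
  ∫ y in (0:ℝ)..x, (y * P.Bθ y ^ 2 - 2 * P.μ₀ * y ^ 2 * deriv P.p y)

/-- THE FIRST-ORDER FLUX AMPLITUDE `ψ̄₁(r) = B_θ(r) ∫_a^r dx/(x B_θ²(x)) ∫_0^x [y B_θ² − 2μ₀ y² p′] dy`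
(`ψ₁ = ψ̄₁ cos θ`, (6.64)), with the integration constants `r₁ = 0` (regularity at the axis) and
`r₂ = a` (the last closed surface `r = a` centred: `ψ̄₁(a) = 0`, (6.76)). [cite: Freidberg2014, §6.4.6 eq. (6.77)]
(also (6.73) for the conducting-wall RFP) -/
def psiBar1 (a r : ℝ) : ℝ :=
  P.Bθ r * ∫ x in a..r, P.torBracket x / (x * P.Bθ x ^ 2)

/-- THE SHIFT of the circular flux surface of minor radius `r` along `R` (major radius `R₀`):
`Δ(r) = −ψ̄₁(r)/(R₀ B_θ(r))`. [cite: Freidberg2014, §6.4.4 eq. (6.72)] -/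
def fluxShift (R₀ a r : ℝ) : ℝ := -P.psiBar1 a r / (R₀ * P.Bθ r)

/-- THE NORMALISED INTERNAL INDUCTANCE per unit length `l_i = (2/(a² B_θa²)) ∫_0^a B_θ²(y) y dy`
(`= ⟨B_θ²⟩/B_θa²` with the tree's cross-section average). [cite: Freidberg2014, §6.4.6 eq. (6.86)] -/
def internalInductance (a : ℝ) : ℝ := areaAvg (fun r => P.Bθ r ^ 2) a / P.Bθ a ^ 2

/-- SHAFRANOV'S VERTICAL FIELD `B_V = (μ₀ I/(4π R₀)) (β_p + (l_i − 3)/2 + ln(8R₀/a))` for toroidal current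
`I`, major radius `R₀`, minor radius `a`, poloidal beta `β_p` and internal inductance `l_i` «first derived by
Shafranov (1966)». [cite: Freidberg2014, §6.4.6 eq. (6.90)] -/
def shafranovVerticalField (μ₀ I R₀ a βp li : ℝ) : ℝ :=
  μ₀ * I / (4 * π * R₀) * (βp + (li - 3) / 2 + Real.log (8 * R₀ / a))

/-- THE FAR FIELD the plasma solution must match for `a ≪ r ≪ R₀`: the `cos θ` amplitude of the flux of a
current loop `I` of radius `R₀` plus a uniform vertical field `B_V`,
`ψ̄₁(r) → −(μ₀ I/4π)(ln(8R₀/r) − 1) r + R₀ B_V r`. [cite: Freidberg2014, §6.4.6 eq. (6.82)] -/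
def psiBar1Far (μ₀ I R₀ BV r : ℝ) : ℝ :=
  -(μ₀ * I / (4 * π)) * (Real.log (8 * R₀ / r) - 1) * r + R₀ * BV * r

/-- Unfolding of `internalInductance`: `a² B_θa² l_i / 2 = ∫_0^a y B_θ² dy` for `a ≠ 0`, `B_θ(a) ≠ 0`.
[cite: Freidberg2014, §6.4.6 eq. (6.86)] -/
theorem sq_mul_internalInductance {a : ℝ} (ha : a ≠ 0) (hBa : P.Bθ a ≠ 0) :
    a ^ 2 * P.Bθ a ^ 2 * P.internalInductance a / 2 = ∫ y in (0:ℝ)..a, y * P.Bθ y ^ 2 := by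
  unfold internalInductance areaAvg
  have e : ∫ r in (0:ℝ)..a, P.Bθ r ^ 2 * r = ∫ y in (0:ℝ)..a, y * P.Bθ y ^ 2 :=
    intervalIntegral.integral_congr fun r _ => by ring
  rw [e]
  field_simp

/-- Unfolding of `rfpBetaP` (6.83, last equality): `a² B_θa² β_p = 4μ₀ ∫_0^a p y dy` for `a ≠ 0`,
`B_θ(a) ≠ 0`. [cite: Freidberg2014, §6.4.6 eq. (6.83)] -/
theorem sq_mul_rfpBetaP {a : ℝ} (ha : a ≠ 0) (hBa : P.Bθ a ≠ 0) :
    a ^ 2 * P.Bθ a ^ 2 * P.rfpBetaP a = 4 * P.μ₀ * ∫ y in (0:ℝ)..a, P.p y * y := by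
  unfold rfpBetaP areaAvg
  field_simp
  ring

/-! ## §2 The interior: `ψ̄₁` solves (6.65)–(6.66); the shift is outward; its edge slope -/

/-- The square bracket vanishes at the axis. [cite: Freidberg2014, §6.4.4 eq. (6.66)] -/
theorem torBracket_zero : P.torBracket 0 = 0 := by
  unfold torBracket
  simp

/-- FTC for the square bracket: `d/dx ∫_0^x [y B_θ² − 2μ₀ y² p′] dy = x B_θ(x)² − 2μ₀ x² p′(x)` at every
`x > 0`, the integrand being continuous on `[0, ∞)`. [cite: Freidberg2014, §6.4.4 eq. (6.66)] -/
theorem hasDerivAt_torBracket {x : ℝ} (hx : 0 < x)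
    (hg : ContinuousOn (fun y => y * P.Bθ y ^ 2 - 2 * P.μ₀ * y ^ 2 * deriv P.p y) (Ici 0)) :
    HasDerivAt P.torBracket (x * P.Bθ x ^ 2 - 2 * P.μ₀ * x ^ 2 * deriv P.p x) x := by
  have hxI : Ici (0:ℝ) ∈ 𝓝 x := mem_of_superset (Ioi_mem_nhds hx) Ioi_subset_Ici_self
  have hca : ContinuousAt (fun y => y * P.Bθ y ^ 2 - 2 * P.μ₀ * y ^ 2 * deriv P.p y) x :=
    hg.continuousAt hxI
  have hmeas := (hg.mono Ioi_subset_Ici_self).stronglyMeasurableAtFilter (μ := volume) isOpen_Ioi x hx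
  have hii : IntervalIntegrable (fun y => y * P.Bθ y ^ 2 - 2 * P.μ₀ * y ^ 2 * deriv P.p y) volume 0 x :=
    (hg.mono (by rw [uIcc_of_le hx.le]; exact Icc_subset_Ici_self)).intervalIntegrable
  have h := intervalIntegral.integral_hasDerivAt_right hii hmeas hca
  exact h

/-- The square bracket is continuous on `(0, ∞)` (indeed differentiable). [cite: Freidberg2014, §6.4.4 eq. (6.66)] -/
theorem continuousOn_torBracket
    (hg : ContinuousOn (fun y => y * P.Bθ y ^ 2 - 2 * P.μ₀ * y ^ 2 * deriv P.p y) (Ici 0)) :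
    ContinuousOn P.torBracket (Ioi 0) := fun _ hx =>
  (P.hasDerivAt_torBracket hx hg).continuousAt.continuousWithinAt

/-- The inner integrand `x ↦ bracket(x)/(x B_θ(x)²)` of (6.67) is continuous on `(0, ∞)` when `B_θ ≠ 0` there.
[cite: Freidberg2014, §6.4.4 eq. (6.67)] -/
theorem continuousOn_torBracket_div (hBθc : ContinuousOn P.Bθ (Ici 0)) (hBθ : ∀ r, 0 < r → P.Bθ r ≠ 0)
    (hg : ContinuousOn (fun y => y * P.Bθ y ^ 2 - 2 * P.μ₀ * y ^ 2 * deriv P.p y) (Ici 0)) :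
    ContinuousOn (fun x => P.torBracket x / (x * P.Bθ x ^ 2)) (Ioi 0) := by
  refine (P.continuousOn_torBracket hg).div
    (continuousOn_id.mul ((hBθc.mono Ioi_subset_Ici_self).pow 2)) fun x hx => ?_
  exact mul_ne_zero (ne_of_gt hx) (pow_ne_zero 2 (hBθ x hx))

/-- **(6.66): `ψ̄₁` IS A FIRST INTEGRAL.**  For `B_θ` continuous and non-vanishing on `(0, ∞)` and the bracket
integrand continuous on `[0, ∞)`: at every `r > 0` (and `a > 0`),
`d/dr (ψ̄₁(r)/B_θ(r)) = (1/(r B_θ(r)²)) ∫_0^r [y B_θ² − 2μ₀ y² p′] dy`. [cite: Freidberg2014, §6.4.4 eq. (6.66)] -/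
theorem hasDerivAt_psiBar1_div {a r : ℝ} (ha : 0 < a) (hr : 0 < r) (hBθc : ContinuousOn P.Bθ (Ici 0))
    (hBθ : ∀ r, 0 < r → P.Bθ r ≠ 0)
    (hg : ContinuousOn (fun y => y * P.Bθ y ^ 2 - 2 * P.μ₀ * y ^ 2 * deriv P.p y) (Ici 0)) :
    HasDerivAt (fun s => P.psiBar1 a s / P.Bθ s) (P.torBracket r / (r * P.Bθ r ^ 2)) r := by
  have hG := P.continuousOn_torBracket_div hBθc hBθ hg
  have hsub : uIcc a r ⊆ Ioi 0 := fun x hx => by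
    rcases le_total a r with h | h
    · rw [uIcc_of_le h] at hx; exact lt_of_lt_of_le ha hx.1
    · rw [uIcc_of_ge h] at hx; exact lt_of_lt_of_le hr hx.1
  have hii : IntervalIntegrable (fun x => P.torBracket x / (x * P.Bθ x ^ 2)) volume a r :=
    (hG.mono hsub).intervalIntegrable
  have hmeas := hG.stronglyMeasurableAtFilter (μ := volume) isOpen_Ioi r hr
  have hca : ContinuousAt (fun x => P.torBracket x / (x * P.Bθ x ^ 2)) r := hG.continuousAt (Ioi_mem_nhds hr)
  have h := intervalIntegral.integral_hasDerivAt_right hii hmeas hca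
  -- `ψ̄₁/B_θ = ∫_a^s (…)` near `r` (where `B_θ ≠ 0`)
  refine h.congr_of_eventuallyEq ?_
  filter_upwards [Ioi_mem_nhds hr] with s hs
  unfold psiBar1
  rw [mul_div_cancel_left₀ _ (hBθ s hs)]

/-- **(6.65): THE FIRST-ORDER TOROIDAL EQUATION IS SOLVED BY `ψ̄₁`.**  Same data:
`d/dr [ r B_θ(r)² · d/dr(ψ̄₁/B_θ) ] = r B_θ(r)² − 2μ₀ r² p′(r)` at every `r > 0`.
[cite: Freidberg2014, §6.4.4 eq. (6.65)] -/
theorem psiBar1_secondOrder {a r : ℝ} (ha : 0 < a) (hr : 0 < r) (hBθc : ContinuousOn P.Bθ (Ici 0))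
    (hBθ : ∀ r, 0 < r → P.Bθ r ≠ 0)
    (hg : ContinuousOn (fun y => y * P.Bθ y ^ 2 - 2 * P.μ₀ * y ^ 2 * deriv P.p y) (Ici 0)) :
    HasDerivAt (fun s => s * P.Bθ s ^ 2 * deriv (fun t => P.psiBar1 a t / P.Bθ t) s)
      (r * P.Bθ r ^ 2 - 2 * P.μ₀ * r ^ 2 * deriv P.p r) r := by
  have hev : (fun s => s * P.Bθ s ^ 2 * deriv (fun t => P.psiBar1 a t / P.Bθ t) s) =ᶠ[𝓝 r] P.torBracket := by
    filter_upwards [Ioi_mem_nhds hr] with s hs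
    rw [(P.hasDerivAt_psiBar1_div ha hs hBθc hBθ hg).deriv]
    have h1 : s ≠ 0 := ne_of_gt hs
    have h2 : P.Bθ s ≠ 0 := hBθ s hs
    field_simp
  exact (P.hasDerivAt_torBracket hr hg).congr_of_eventuallyEq hev

/-- `ψ̄₁(a) = 0`: the last closed surface is centred. [cite: Freidberg2014, §6.4.6 eq. (6.76)] -/
theorem psiBar1_self (a : ℝ) : P.psiBar1 a a = 0 := by
  unfold psiBar1
  simp

/-- «`Δ_a = 0`»: the shift of the last closed flux surface vanishes. [cite: Freidberg2014, §6.4.6 eq. (6.76)] -/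
theorem fluxShift_edge (R₀ a : ℝ) : P.fluxShift R₀ a a = 0 := by
  unfold fluxShift
  rw [P.psiBar1_self, neg_zero, zero_div]

/-- THE SHIFT AS ONE INTEGRAL: `Δ(r) = (1/R₀) ∫_r^a bracket(x)/(x B_θ(x)²) dx` (`B_θ(r) ≠ 0`, `R₀ ≠ 0`).
[cite: Freidberg2014, §6.4.4 eqs. (6.67), (6.72)] -/
theorem fluxShift_eq_integral {R₀ a r : ℝ} (hR : R₀ ≠ 0) (hBr : P.Bθ r ≠ 0) :
    P.fluxShift R₀ a r = 1 / R₀ * ∫ x in r..a, P.torBracket x / (x * P.Bθ x ^ 2) := by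
  unfold fluxShift psiBar1
  rw [intervalIntegral.integral_symm a r]
  field_simp

/-- THE BRACKET IS POSITIVE for a confined profile: `μ₀ ≥ 0`, `B_θ ≠ 0` and `p′ ≤ 0` on `(0, x)` give
`∫_0^x [y B_θ² − 2μ₀ y² p′] dy > 0` (`x > 0`). [cite: Freidberg2014, §6.4.4 eq. (6.72)] -/
theorem torBracket_pos {x : ℝ} (hx : 0 < x) (hμ : 0 ≤ P.μ₀) (hBθ : ∀ r, 0 < r → P.Bθ r ≠ 0)
    (hp' : ∀ y ∈ Ioo 0 x, deriv P.p y ≤ 0)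
    (hg : ContinuousOn (fun y => y * P.Bθ y ^ 2 - 2 * P.μ₀ * y ^ 2 * deriv P.p y) (Ici 0)) :
    0 < P.torBracket x := by
  unfold torBracket
  apply intervalIntegral.intervalIntegral_pos_of_pos_on
  · exact (hg.mono (by rw [uIcc_of_le hx.le]; exact Icc_subset_Ici_self)).intervalIntegrable
  · intro y hy
    have hB : 0 < P.Bθ y ^ 2 := lt_of_le_of_ne (sq_nonneg _) (Ne.symm (pow_ne_zero 2 (hBθ y hy.1)))
    have h1 : 0 < y * P.Bθ y ^ 2 := mul_pos hy.1 hB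
    have h2 : P.μ₀ * y ^ 2 * deriv P.p y ≤ 0 := by
      nlinarith [mul_nonneg hμ (sq_nonneg y), hp' y hy]
    linarith
  · exact hx

/-- **«THE SHIFT IS OUTWARD»** (text after (6.72)): for `R₀ > 0`, `μ₀ ≥ 0`, `B_θ ≠ 0` on `(0, ∞)` and
`p′ ≤ 0` on `(0, a)`, every interior surface `0 < r < a` is shifted outward relative to the last one:
`Δ(r) > 0` (`Δ(a) = 0`). [cite: Freidberg2014, §6.4.4 eq. (6.72)] -/
theorem fluxShift_pos {R₀ a r : ℝ} (hR : 0 < R₀) (hr : 0 < r) (hra : r < a) (hμ : 0 ≤ P.μ₀)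
    (hBθc : ContinuousOn P.Bθ (Ici 0)) (hBθ : ∀ r, 0 < r → P.Bθ r ≠ 0)
    (hp' : ∀ y ∈ Ioo 0 a, deriv P.p y ≤ 0)
    (hg : ContinuousOn (fun y => y * P.Bθ y ^ 2 - 2 * P.μ₀ * y ^ 2 * deriv P.p y) (Ici 0)) :
    0 < P.fluxShift R₀ a r := by
  rw [P.fluxShift_eq_integral hR.ne' (hBθ r hr)]
  have hG := P.continuousOn_torBracket_div hBθc hBθ hg
  have hpos : 0 < ∫ x in r..a, P.torBracket x / (x * P.Bθ x ^ 2) := by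
    apply intervalIntegral.intervalIntegral_pos_of_pos_on
    · exact (hG.mono fun x hx => by
        rw [uIcc_of_le hra.le] at hx
        exact lt_of_lt_of_le hr hx.1).intervalIntegrable
    · intro x hx
      have hx0 : 0 < x := hr.trans hx.1
      have hB : 0 < P.Bθ x ^ 2 := lt_of_le_of_ne (sq_nonneg _) (Ne.symm (pow_ne_zero 2 (hBθ x hx0)))
      have hb := P.torBracket_pos hx0 hμ hBθ (fun y hy => hp' y ⟨hy.1, hy.2.trans hx.2⟩) hg
      exact div_pos hb (mul_pos hx0 hB)
    · exact hra
  exact mul_pos (one_div_pos.mpr hR) hpos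

/-- **(6.83): THE TIRE-TUBE TERM IS `a² B_θa² β_p`.**  For `p` continuous on `[0, a]`, differentiable on
`(0, a)` with `y² p′` integrable, and `p(a) = 0`: `−∫_0^a 2μ₀ y² p′ dy = 4μ₀ ∫_0^a p y dy = a² B_θa² β_p`
(integration by parts; `β_p = 2μ₀⟨p⟩/B_θa²` is the tree's `rfpBetaP`). [cite: Freidberg2014, §6.4.6 eq. (6.83)] -/
theorem neg_integral_pressure_term {a : ℝ} (ha : 0 < a) (hpc : ContinuousOn P.p (Icc 0 a))
    (hpd : ∀ y ∈ Ioo 0 a, DifferentiableAt ℝ P.p y)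
    (hpi : IntervalIntegrable (fun y => y ^ 2 * deriv P.p y) volume 0 a) (hpa : P.p a = 0) :
    -(∫ y in (0:ℝ)..a, 2 * P.μ₀ * y ^ 2 * deriv P.p y) = 4 * P.μ₀ * ∫ y in (0:ℝ)..a, P.p y * y := by
  -- `∫_0^a (2 y p + y² p′) = [y² p]_0^a = 0`
  have hΦc : ContinuousOn (fun y => y ^ 2 * P.p y) (Icc 0 a) := (continuousOn_id.pow 2).mul hpc
  have hΦd : ∀ y ∈ Ioo 0 a, HasDerivAt (fun y => y ^ 2 * P.p y) (2 * y * P.p y + y ^ 2 * deriv P.p y) y := by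
    intro y hy
    have h1 : HasDerivAt (fun y : ℝ => y ^ 2) (2 * y) y := by simpa using hasDerivAt_pow 2 y
    have h := h1.mul (hpd y hy).hasDerivAt
    exact h.congr_deriv (by ring)
  have hpy : IntervalIntegrable (fun y => 2 * y * P.p y) volume 0 a :=
    ((continuousOn_const.mul continuousOn_id).mul hpc).mono (by rw [uIcc_of_le ha.le]) |>.intervalIntegrable
  have hint : IntervalIntegrable (fun y => 2 * y * P.p y + y ^ 2 * deriv P.p y) volume 0 a := hpy.add hpi
  have hFTC := intervalIntegral.integral_eq_sub_of_hasDerivAt_of_le ha.le hΦc hΦd hint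
  simp only [hpa, mul_zero, ne_eq, OfNat.ofNat_ne_zero, not_false_eq_true, zero_pow, zero_mul,
    sub_zero] at hFTC
  rw [intervalIntegral.integral_add hpy hpi] at hFTC
  have e1 : ∫ y in (0:ℝ)..a, 2 * P.μ₀ * y ^ 2 * deriv P.p y = 2 * P.μ₀ * ∫ y in (0:ℝ)..a, y ^ 2 * deriv P.p y := by
    rw [← intervalIntegral.integral_const_mul]
    exact intervalIntegral.integral_congr fun y _ => by ring
  have e2 : ∫ y in (0:ℝ)..a, 2 * y * P.p y = 2 * ∫ y in (0:ℝ)..a, P.p y * y := by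
    rw [← intervalIntegral.integral_const_mul]
    exact intervalIntegral.integral_congr fun y _ => by ring
  rw [e2] at hFTC
  have h3 : ∫ y in (0:ℝ)..a, y ^ 2 * deriv P.p y = -2 * ∫ y in (0:ℝ)..a, P.p y * y := by linarith
  rw [e1, h3]
  ring

/-- **(6.87) AT THE PLASMA EDGE (no assumption outside the plasma):**
`∫_0^a [y B_θ² − 2μ₀ y² p′] dy = a² B_θa² (β_p + l_i/2)`. [cite: Freidberg2014, §6.4.6 eqs. (6.83), (6.86), (6.87)] -/
theorem torBracket_edge {a : ℝ} (ha : 0 < a) (hBa : P.Bθ a ≠ 0) (hBθc : ContinuousOn P.Bθ (Icc 0 a))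
    (hpc : ContinuousOn P.p (Icc 0 a)) (hpd : ∀ y ∈ Ioo 0 a, DifferentiableAt ℝ P.p y)
    (hpi : IntervalIntegrable (fun y => y ^ 2 * deriv P.p y) volume 0 a) (hpa : P.p a = 0) :
    P.torBracket a = a ^ 2 * P.Bθ a ^ 2 * (P.rfpBetaP a + P.internalInductance a / 2) := by
  unfold torBracket
  have hI1 : IntervalIntegrable (fun y => y * P.Bθ y ^ 2) volume 0 a :=
    ((continuousOn_id.mul (hBθc.pow 2)).mono (by rw [uIcc_of_le ha.le])).intervalIntegrable
  have hI2 : IntervalIntegrable (fun y => 2 * P.μ₀ * y ^ 2 * deriv P.p y) volume 0 a := by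
    have e : (fun y => 2 * P.μ₀ * y ^ 2 * deriv P.p y) = fun y => (2 * P.μ₀) * (y ^ 2 * deriv P.p y) := by
      funext y; ring
    rw [e]
    exact hpi.const_mul _
  rw [intervalIntegral.integral_sub hI1 hI2, ← P.sq_mul_internalInductance ha.ne' hBa, sub_eq_add_neg,
    P.neg_integral_pressure_term ha hpc hpd hpi hpa, ← P.sq_mul_rfpBetaP ha.ne' hBa]
  ring

/-- **THE SLOPE OF THE SHIFT**: `Δ′(r) = −bracket(r)/(R₀ r B_θ(r)²)` at every `r > 0` (`B_θ` continuous and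
non-vanishing on `(0, ∞)`, bracket integrand continuous on `[0, ∞)`, `R₀ ≠ 0`).
[cite: Freidberg2014, §6.4.4 eqs. (6.66), (6.72)] -/
theorem hasDerivAt_fluxShift {R₀ a r : ℝ} (hR : R₀ ≠ 0) (ha : 0 < a) (hr : 0 < r)
    (hBθc : ContinuousOn P.Bθ (Ici 0)) (hBθ : ∀ r, 0 < r → P.Bθ r ≠ 0)
    (hg : ContinuousOn (fun y => y * P.Bθ y ^ 2 - 2 * P.μ₀ * y ^ 2 * deriv P.p y) (Ici 0)) :
    HasDerivAt (fun s => P.fluxShift R₀ a s) (-(P.torBracket r / (R₀ * r * P.Bθ r ^ 2))) r := by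
  have h := (P.hasDerivAt_psiBar1_div ha hr hBθc hBθ hg).const_mul (-(1 / R₀))
  have hev : (fun s => -(1 / R₀) * (P.psiBar1 a s / P.Bθ s)) =ᶠ[𝓝 r] fun s => P.fluxShift R₀ a s := by
    filter_upwards [Ioi_mem_nhds hr] with s hs
    unfold fluxShift
    have h2 : P.Bθ s ≠ 0 := hBθ s hs
    field_simp
  refine (h.congr_of_eventuallyEq hev.symm).congr_deriv ?_
  have h1 : r ≠ 0 := ne_of_gt hr
  have h2 : P.Bθ r ≠ 0 := hBθ r hr
  field_simp

/-- **THE EDGE SLOPE OF THE SHAFRANOV SHIFT: `Δ′(a) = −(a/R₀)(β_p + l_i/2)`** (from (6.72), (6.66) at `r = a`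
and (6.87) at the edge: the interior surfaces are displaced outward relative to the boundary at the rate
`(a/R₀)(β_p + l_i/2)`).  Hypotheses as `hasDerivAt_fluxShift` and `torBracket_edge`.
[cite: Freidberg2014, §6.4.6 eqs. (6.72), (6.83), (6.86), (6.87)] -/
theorem hasDerivAt_fluxShift_edge {R₀ a : ℝ} (hR : R₀ ≠ 0) (ha : 0 < a)
    (hBθc : ContinuousOn P.Bθ (Ici 0)) (hBθ : ∀ r, 0 < r → P.Bθ r ≠ 0)
    (hg : ContinuousOn (fun y => y * P.Bθ y ^ 2 - 2 * P.μ₀ * y ^ 2 * deriv P.p y) (Ici 0))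
    (hpc : ContinuousOn P.p (Icc 0 a)) (hpd : ∀ y ∈ Ioo 0 a, DifferentiableAt ℝ P.p y)
    (hpi : IntervalIntegrable (fun y => y ^ 2 * deriv P.p y) volume 0 a) (hpa : P.p a = 0) :
    HasDerivAt (fun s => P.fluxShift R₀ a s) (-(a / R₀ * (P.rfpBetaP a + P.internalInductance a / 2))) a := by
  have h := P.hasDerivAt_fluxShift hR ha ha hBθc hBθ hg
  rw [P.torBracket_edge ha (hBθ a ha) (hBθc.mono Icc_subset_Ici_self) hpc hpd hpi hpa] at h
  refine h.congr_deriv ?_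
  have h1 : a ≠ 0 := ha.ne'
  have h2 : P.Bθ a ≠ 0 := hBθ a ha
  field_simp

/-! ## §2b The same with hypotheses on `[0, a]` only (a profile given up to the plasma edge; edge slope as a
LEFT derivative) — the forms a model equilibrium defined by formulas valid on `0 ≤ r ≤ a` can discharge -/

/-- The square bracket is continuous on `[0, b]` when its integrand is. [cite: Freidberg2014, §6.4.4 eq. (6.66)] -/
theorem continuousOn_torBracket_Icc {b : ℝ}
    (hg : ContinuousOn (fun y => y * P.Bθ y ^ 2 - 2 * P.μ₀ * y ^ 2 * deriv P.p y) (Icc 0 b)) :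
    ContinuousOn P.torBracket (Icc 0 b) := by
  rcases le_or_gt 0 b with hb | hb
  · have h := intervalIntegral.continuousOn_primitive_interval' (μ := volume) (a := (0:ℝ)) (b₁ := 0) (b₂ := b)
      ((hg.mono (by rw [uIcc_of_le hb])).intervalIntegrable) (by rw [uIcc_of_le hb]; exact ⟨le_rfl, hb⟩)
    rw [uIcc_of_le hb] at h
    exact h.congr fun x _ => rfl
  · rw [Icc_eq_empty (not_le.mpr hb)]
    exact continuousOn_empty _

/-- FTC for the square bracket at an interior point `x ∈ (0, b)`, the integrand continuous on `[0, b]`.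
[cite: Freidberg2014, §6.4.4 eq. (6.66)] -/
theorem hasDerivAt_torBracket_of_mem_Ioo {b x : ℝ} (hx : x ∈ Ioo 0 b)
    (hg : ContinuousOn (fun y => y * P.Bθ y ^ 2 - 2 * P.μ₀ * y ^ 2 * deriv P.p y) (Icc 0 b)) :
    HasDerivAt P.torBracket (x * P.Bθ x ^ 2 - 2 * P.μ₀ * x ^ 2 * deriv P.p x) x := by
  have hxI : Icc (0:ℝ) b ∈ 𝓝 x := Icc_mem_nhds hx.1 hx.2
  have hca : ContinuousAt (fun y => y * P.Bθ y ^ 2 - 2 * P.μ₀ * y ^ 2 * deriv P.p y) x := hg.continuousAt hxI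
  have hmeas := (hg.mono Ioo_subset_Icc_self).stronglyMeasurableAtFilter (μ := volume) isOpen_Ioo x hx
  have hii : IntervalIntegrable (fun y => y * P.Bθ y ^ 2 - 2 * P.μ₀ * y ^ 2 * deriv P.p y) volume 0 x :=
    (hg.mono (by rw [uIcc_of_le hx.1.le]; exact Icc_subset_Icc_right hx.2.le)).intervalIntegrable
  exact intervalIntegral.integral_hasDerivAt_right hii hmeas hca

/-- The inner integrand `x ↦ bracket(x)/(x B_θ(x)²)` of (6.67) is continuous on `(0, b]` when `B_θ` is continuous on
`[0, b]` and non-vanishing on `(0, b]`. [cite: Freidberg2014, §6.4.4 eq. (6.67)] -/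
theorem continuousOn_torBracket_div_Ioc {b : ℝ} (hBθc : ContinuousOn P.Bθ (Icc 0 b))
    (hBθ : ∀ r ∈ Ioc 0 b, P.Bθ r ≠ 0)
    (hg : ContinuousOn (fun y => y * P.Bθ y ^ 2 - 2 * P.μ₀ * y ^ 2 * deriv P.p y) (Icc 0 b)) :
    ContinuousOn (fun x => P.torBracket x / (x * P.Bθ x ^ 2)) (Ioc 0 b) := by
  refine ((P.continuousOn_torBracket_Icc hg).mono Ioc_subset_Icc_self).div
    (continuousOn_id.mul ((hBθc.mono Ioc_subset_Icc_self).pow 2)) fun x hx => ?_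
  exact mul_ne_zero (ne_of_gt hx.1) (pow_ne_zero 2 (hBθ x hx))

/-- THE BRACKET IS POSITIVE (local form): `μ₀ ≥ 0`, `B_θ ≠ 0` and `p′ ≤ 0` on `(0, x)`, the integrand continuous on
`[0, x]`. [cite: Freidberg2014, §6.4.4 eq. (6.72)] -/
theorem torBracket_pos_of_Icc {x : ℝ} (hx : 0 < x) (hμ : 0 ≤ P.μ₀) (hBθ : ∀ r ∈ Ioo 0 x, P.Bθ r ≠ 0)
    (hp' : ∀ y ∈ Ioo 0 x, deriv P.p y ≤ 0)
    (hg : ContinuousOn (fun y => y * P.Bθ y ^ 2 - 2 * P.μ₀ * y ^ 2 * deriv P.p y) (Icc 0 x)) :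
    0 < P.torBracket x := by
  unfold torBracket
  apply intervalIntegral.intervalIntegral_pos_of_pos_on
  · exact (hg.mono (by rw [uIcc_of_le hx.le])).intervalIntegrable
  · intro y hy
    have hB : 0 < P.Bθ y ^ 2 := lt_of_le_of_ne (sq_nonneg _) (Ne.symm (pow_ne_zero 2 (hBθ y hy)))
    have h1 : 0 < y * P.Bθ y ^ 2 := mul_pos hy.1 hB
    have h2 : P.μ₀ * y ^ 2 * deriv P.p y ≤ 0 := by
      nlinarith [mul_nonneg hμ (sq_nonneg y), hp' y hy]
    linarith
  · exact hx

/-- **«THE SHIFT IS OUTWARD»** (local form): `R₀ > 0`, `μ₀ ≥ 0`, `B_θ` continuous on `[0, a]` and non-vanishing on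
`(0, a]`, `p′ ≤ 0` on `(0, a)`, the bracket integrand continuous on `[0, a]` ⇒ `Δ(r) > 0` for `0 < r < a`.
[cite: Freidberg2014, §6.4.4 eq. (6.72)] -/
theorem fluxShift_pos_of_Icc {R₀ a r : ℝ} (hR : 0 < R₀) (hr : 0 < r) (hra : r < a) (hμ : 0 ≤ P.μ₀)
    (hBθc : ContinuousOn P.Bθ (Icc 0 a)) (hBθ : ∀ r ∈ Ioc 0 a, P.Bθ r ≠ 0)
    (hp' : ∀ y ∈ Ioo 0 a, deriv P.p y ≤ 0)
    (hg : ContinuousOn (fun y => y * P.Bθ y ^ 2 - 2 * P.μ₀ * y ^ 2 * deriv P.p y) (Icc 0 a)) :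
    0 < P.fluxShift R₀ a r := by
  rw [P.fluxShift_eq_integral hR.ne' (hBθ r ⟨hr, hra.le⟩)]
  have hG := P.continuousOn_torBracket_div_Ioc hBθc hBθ hg
  have hpos : 0 < ∫ x in r..a, P.torBracket x / (x * P.Bθ x ^ 2) := by
    apply intervalIntegral.intervalIntegral_pos_of_pos_on
    · exact (hG.mono fun x hx => by
        rw [uIcc_of_le hra.le] at hx
        exact ⟨lt_of_lt_of_le hr hx.1, hx.2⟩).intervalIntegrable
    · intro x hx
      have hx0 : 0 < x := hr.trans hx.1
      have hB : 0 < P.Bθ x ^ 2 :=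
        lt_of_le_of_ne (sq_nonneg _) (Ne.symm (pow_ne_zero 2 (hBθ x ⟨hx0, hx.2.le⟩)))
      have hb := P.torBracket_pos_of_Icc hx0 hμ (fun y hy => hBθ y ⟨hy.1, (hy.2.trans hx.2).le⟩)
        (fun y hy => hp' y ⟨hy.1, hy.2.trans hx.2⟩) (hg.mono (Icc_subset_Icc_right hx.2.le))
      exact div_pos hb (mul_pos hx0 hB)
    · exact hra
  exact mul_pos (one_div_pos.mpr hR) hpos

/-- **(6.66) local form:** `d/dr(ψ̄₁/B_θ) = bracket(r)/(r B_θ(r)²)` at every interior `r ∈ (0, b)`, for `a ∈ (0, b]`,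
`B_θ` continuous on `[0, b]` and non-vanishing on `(0, b]`, the bracket integrand continuous on `[0, b]`.
[cite: Freidberg2014, §6.4.4 eq. (6.66)] -/
theorem hasDerivAt_psiBar1_div_of_mem_Ioo {a b r : ℝ} (ha : a ∈ Ioc 0 b) (hr : r ∈ Ioo 0 b)
    (hBθc : ContinuousOn P.Bθ (Icc 0 b)) (hBθ : ∀ r ∈ Ioc 0 b, P.Bθ r ≠ 0)
    (hg : ContinuousOn (fun y => y * P.Bθ y ^ 2 - 2 * P.μ₀ * y ^ 2 * deriv P.p y) (Icc 0 b)) :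
    HasDerivAt (fun s => P.psiBar1 a s / P.Bθ s) (P.torBracket r / (r * P.Bθ r ^ 2)) r := by
  have hG := P.continuousOn_torBracket_div_Ioc hBθc hBθ hg
  have hsub : uIcc a r ⊆ Ioc 0 b := fun x hx => by
    rcases le_total a r with h | h
    · rw [uIcc_of_le h] at hx; exact ⟨lt_of_lt_of_le ha.1 hx.1, hx.2.trans hr.2.le⟩
    · rw [uIcc_of_ge h] at hx; exact ⟨lt_of_lt_of_le hr.1 hx.1, hx.2.trans ha.2⟩
  have hii : IntervalIntegrable (fun x => P.torBracket x / (x * P.Bθ x ^ 2)) volume a r :=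
    (hG.mono hsub).intervalIntegrable
  have hmeas := ((hG.mono Ioo_subset_Ioc_self).stronglyMeasurableAtFilter (μ := volume) isOpen_Ioo r hr)
  have hca : ContinuousAt (fun x => P.torBracket x / (x * P.Bθ x ^ 2)) r :=
    (hG.mono Ioo_subset_Ioc_self).continuousAt (Ioo_mem_nhds hr.1 hr.2)
  have h := intervalIntegral.integral_hasDerivAt_right hii hmeas hca
  refine h.congr_of_eventuallyEq ?_
  filter_upwards [Ioo_mem_nhds hr.1 hr.2] with s hs
  unfold psiBar1
  rw [mul_div_cancel_left₀ _ (hBθ s ⟨hs.1, hs.2.le⟩)]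

/-- `dΔ/dr = −bracket(r)/(R₀ r B_θ(r)²)` at every interior `r ∈ (0, a)` (local form).
[cite: Freidberg2014, §6.4.4 eq. (6.72)] -/
theorem hasDerivAt_fluxShift_of_mem_Ioo {R₀ a r : ℝ} (hR : R₀ ≠ 0) (ha : 0 < a) (hr : r ∈ Ioo 0 a)
    (hBθc : ContinuousOn P.Bθ (Icc 0 a)) (hBθ : ∀ r ∈ Ioc 0 a, P.Bθ r ≠ 0)
    (hg : ContinuousOn (fun y => y * P.Bθ y ^ 2 - 2 * P.μ₀ * y ^ 2 * deriv P.p y) (Icc 0 a)) :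
    HasDerivAt (fun s => P.fluxShift R₀ a s) (-(P.torBracket r / (R₀ * r * P.Bθ r ^ 2))) r := by
  have h := (P.hasDerivAt_psiBar1_div_of_mem_Ioo ⟨ha, le_rfl⟩ hr hBθc hBθ hg).const_mul (-(1 / R₀))
  have hev : (fun s => -(1 / R₀) * (P.psiBar1 a s / P.Bθ s)) =ᶠ[𝓝 r] fun s => P.fluxShift R₀ a s := by
    filter_upwards [Ioo_mem_nhds hr.1 hr.2] with s hs
    unfold fluxShift
    have h2 : P.Bθ s ≠ 0 := hBθ s ⟨hs.1, hs.2.le⟩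
    field_simp
  refine (h.congr_of_eventuallyEq hev.symm).congr_deriv ?_
  have h1 : r ≠ 0 := ne_of_gt hr.1
  have h2 : P.Bθ r ≠ 0 := hBθ r ⟨hr.1, hr.2.le⟩
  field_simp

/-- **THE EDGE SLOPE OF THE SHIFT AS A LEFT DERIVATIVE, `Δ′(a⁻) = −(a/R₀)(β_p + l_i/2)`** — hypotheses on `[0, a]`
only: `B_θ` continuous on `[0, a]` and non-vanishing on `(0, a]`, the bracket integrand continuous on `[0, a]`,
`p` continuous on `[0, a]`, differentiable on `(0, a)` with `y²p′` integrable, `p(a) = 0`.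
[cite: Freidberg2014, §6.4.6 eqs. (6.83), (6.86)–(6.88)] -/
theorem hasDerivWithinAt_fluxShift_edge {R₀ a : ℝ} (hR : R₀ ≠ 0) (ha : 0 < a)
    (hBθc : ContinuousOn P.Bθ (Icc 0 a)) (hBθ : ∀ r ∈ Ioc 0 a, P.Bθ r ≠ 0)
    (hg : ContinuousOn (fun y => y * P.Bθ y ^ 2 - 2 * P.μ₀ * y ^ 2 * deriv P.p y) (Icc 0 a))
    (hpc : ContinuousOn P.p (Icc 0 a)) (hpd : ∀ y ∈ Ioo 0 a, DifferentiableAt ℝ P.p y)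
    (hpi : IntervalIntegrable (fun y => y ^ 2 * deriv P.p y) volume 0 a) (hpa : P.p a = 0) :
    HasDerivWithinAt (fun s => P.fluxShift R₀ a s) (-(a / R₀ * (P.rfpBetaP a + P.internalInductance a / 2)))
      (Iic a) a := by
  set h : ℝ → ℝ := fun x => P.torBracket x / (x * P.Bθ x ^ 2) with hh
  have hG : ContinuousOn h (Ioc 0 a) := P.continuousOn_torBracket_div_Ioc hBθc hBθ hg
  have hfil : 𝓝[Ioc 0 a] a = 𝓝[≤] a := nhdsWithin_Ioc_eq_nhdsLE ha
  have hmeas : StronglyMeasurableAtFilter h (𝓝[≤] a) volume := by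
    rw [← hfil]
    exact hG.stronglyMeasurableAtFilter_nhdsWithin measurableSet_Ioc a
  have hcw : ContinuousWithinAt h (Iic a) a := by
    have h1 : ContinuousWithinAt h (Ioc 0 a) a := hG a ⟨ha, le_rfl⟩
    unfold ContinuousWithinAt at h1 ⊢
    rwa [hfil] at h1
  -- `u ↦ ∫_a^u h` has left derivative `h(a)` at `a`
  have hprim : HasDerivWithinAt (fun u => ∫ x in a..u, h x) (h a) (Iic a) a :=
    intervalIntegral.integral_hasDerivWithinAt_right IntervalIntegrable.refl hmeas hcw
  have hΔ : HasDerivWithinAt (fun u => -(1 / R₀) * ∫ x in a..u, h x) (-(1 / R₀) * h a) (Iic a) a :=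
    hprim.const_mul (-(1 / R₀))
  -- `Δ(u) = −(1/R₀)∫_a^u h` on `(0, a]`
  have hev : (fun s => P.fluxShift R₀ a s) =ᶠ[𝓝[Iic a] a] fun u => -(1 / R₀) * ∫ x in a..u, h x := by
    rw [← hfil]
    filter_upwards [self_mem_nhdsWithin] with u hu
    rw [P.fluxShift_eq_integral hR (hBθ u hu), intervalIntegral.integral_symm u a]
    ring
  have hat : P.fluxShift R₀ a a = -(1 / R₀) * ∫ x in a..a, h x := by
    rw [P.fluxShift_edge, intervalIntegral.integral_same, mul_zero]
  refine (hΔ.congr_of_eventuallyEq hev hat).congr_deriv ?_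
  rw [hh]
  simp only
  rw [P.torBracket_edge ha (hBθ a ⟨ha, le_rfl⟩) hBθc hpc hpd hpi hpa]
  have h1 : a ≠ 0 := ha.ne'
  have h2 : P.Bθ a ≠ 0 := hBθ a ⟨ha, le_rfl⟩
  field_simp

/-! ## §3 With the vacuum region: (6.87), (6.88), and Shafranov's vertical field (6.90) by matching -/

/-- **(6.87): THE SQUARE BRACKET OUTSIDE THE PLASMA.**  If beyond the edge the poloidal field is the vacuum
field `B_θ(y) = B_θa a/y` and the pressure gradient vanishes (`p′ = 0` for `y > a`), then for `x ≥ a`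
`∫_0^x [y B_θ² − 2μ₀ y² p′] dy = a² B_θa² (β_p + l_i/2 + ln(x/a))`. [cite: Freidberg2014, §6.4.6 eqs. (6.84), (6.87)] -/
theorem torBracket_outer {a x : ℝ} (ha : 0 < a) (hax : a ≤ x) (hBa : P.Bθ a ≠ 0)
    (hBθc : ContinuousOn P.Bθ (Icc 0 a))
    (hpc : ContinuousOn P.p (Icc 0 a)) (hpd : ∀ y ∈ Ioo 0 a, DifferentiableAt ℝ P.p y)
    (hpi : IntervalIntegrable (fun y => y ^ 2 * deriv P.p y) volume 0 a) (hpa : P.p a = 0)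
    (hvac : ∀ y, a ≤ y → P.Bθ y = P.Bθ a * a / y) (hp0 : ∀ y, a < y → deriv P.p y = 0) :
    P.torBracket x = a ^ 2 * P.Bθ a ^ 2 * (P.rfpBetaP a + P.internalInductance a / 2 + Real.log (x / a)) := by
  have hx : 0 < x := lt_of_lt_of_le ha hax
  -- on `(a, x)` the integrand is `a² B_θa² / y`
  have hout : ∀ y ∈ Ioo a x, y * P.Bθ y ^ 2 - 2 * P.μ₀ * y ^ 2 * deriv P.p y = a ^ 2 * P.Bθ a ^ 2 * y⁻¹ := by
    intro y hy
    have hy0 : y ≠ 0 := (ha.trans hy.1).ne'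
    rw [hvac y hy.1.le, hp0 y hy.1]
    field_simp
    ring
  have hI1 : IntervalIntegrable (fun y => y * P.Bθ y ^ 2) volume 0 a :=
    ((continuousOn_id.mul (hBθc.pow 2)).mono (by rw [uIcc_of_le ha.le])).intervalIntegrable
  have e2 : (fun y => 2 * P.μ₀ * y ^ 2 * deriv P.p y) = fun y => (2 * P.μ₀) * (y ^ 2 * deriv P.p y) := by
    funext y; ring
  have hI2 : IntervalIntegrable (fun y => 2 * P.μ₀ * y ^ 2 * deriv P.p y) volume 0 a := by
    rw [e2]; exact hpi.const_mul _
  have hIin : IntervalIntegrable (fun y => y * P.Bθ y ^ 2 - 2 * P.μ₀ * y ^ 2 * deriv P.p y) volume 0 a :=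
    hI1.sub hI2
  have hinvc : ContinuousOn (fun y : ℝ => a ^ 2 * P.Bθ a ^ 2 * y⁻¹) (uIcc a x) := by
    rw [uIcc_of_le hax]
    exact continuousOn_const.mul ((continuousOn_inv₀).mono fun y hy => (ha.trans_le hy.1).ne')
  have hinv : IntervalIntegrable (fun y : ℝ => a ^ 2 * P.Bθ a ^ 2 * y⁻¹) volume a x := hinvc.intervalIntegrable
  -- the outer integral equals `∫_a^x a²B_θa²/y = a²B_θa² log(x/a)`
  have hIout_eq : ∫ y in a..x, (y * P.Bθ y ^ 2 - 2 * P.μ₀ * y ^ 2 * deriv P.p y)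
      = a ^ 2 * P.Bθ a ^ 2 * Real.log (x / a) := by
    rw [intervalIntegral_congr_Ioo' hax (fun y hy => hout y hy), intervalIntegral.integral_const_mul,
      integral_inv (by
        rw [uIcc_of_le hax]
        exact fun h => (lt_irrefl (0:ℝ)) (ha.trans_le h.1))]
  have hIout : IntervalIntegrable (fun y => y * P.Bθ y ^ 2 - 2 * P.μ₀ * y ^ 2 * deriv P.p y) volume a x := by
    rw [intervalIntegrable_iff_integrableOn_Ioo_of_le hax] at hinv ⊢
    exact hinv.congr_fun (fun y hy => (hout y hy).symm) measurableSet_Ioo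
  have hsplit : P.torBracket x
      = P.torBracket a + ∫ y in a..x, (y * P.Bθ y ^ 2 - 2 * P.μ₀ * y ^ 2 * deriv P.p y) := by
    unfold torBracket
    rw [intervalIntegral.integral_add_adjacent_intervals hIin hIout]
  rw [hsplit, hIout_eq, P.torBracket_edge ha hBa hBθc hpc hpd hpi hpa]
  ring

/-- **(6.88): `ψ̄₁` OUTSIDE THE PLASMA IN CLOSED FORM.**  Same data; for `r ≥ a`:
`ψ̄₁(r) = (a B_θa/(2r)) [(β_p + l_i/2 − 1/2)(r² − a²) + r² ln(r/a)]` — Freidberg's (6.88) with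
`μ₀I/(4π) = a B_θa/2` (`B_θa = μ₀I/2πa`). [cite: Freidberg2014, §6.4.6 eq. (6.88)] -/
theorem psiBar1_outer {a r : ℝ} (ha : 0 < a) (har : a ≤ r) (hBa : P.Bθ a ≠ 0)
    (hBθc : ContinuousOn P.Bθ (Icc 0 a))
    (hpc : ContinuousOn P.p (Icc 0 a)) (hpd : ∀ y ∈ Ioo 0 a, DifferentiableAt ℝ P.p y)
    (hpi : IntervalIntegrable (fun y => y ^ 2 * deriv P.p y) volume 0 a) (hpa : P.p a = 0)
    (hvac : ∀ y, a ≤ y → P.Bθ y = P.Bθ a * a / y) (hp0 : ∀ y, a < y → deriv P.p y = 0) :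
    P.psiBar1 a r = a * P.Bθ a / (2 * r) *
      ((P.rfpBetaP a + P.internalInductance a / 2 - 1 / 2) * (r ^ 2 - a ^ 2) + r ^ 2 * Real.log (r / a)) := by
  have hr : 0 < r := lt_of_lt_of_le ha har
  set K := P.rfpBetaP a + P.internalInductance a / 2 with hK
  -- the inner integrand on `[a, r]` is `x (K + log(x/a))`
  have hin : ∀ x ∈ uIcc a r, P.torBracket x / (x * P.Bθ x ^ 2) = x * (K + Real.log (x / a)) := by
    intro x hx
    rw [uIcc_of_le har] at hx
    have hx0 : x ≠ 0 := (ha.trans_le hx.1).ne'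
    rw [P.torBracket_outer ha hx.1 hBa hBθc hpc hpd hpi hpa hvac hp0, hvac x hx.1, hK]
    field_simp
  -- an antiderivative: `Φ(x) = K x²/2 + (x²/2) log(x/a) − x²/4`
  have hΦd : ∀ x ∈ Ioo a r, HasDerivAt (fun x => K * x ^ 2 / 2 + x ^ 2 / 2 * Real.log (x / a) - x ^ 2 / 4)
      (x * (K + Real.log (x / a))) x := by
    intro x hx
    have hx0 : x ≠ 0 := (ha.trans hx.1).ne'
    have hxa : x / a ≠ 0 := div_ne_zero hx0 ha.ne'
    have h1 : HasDerivAt (fun x : ℝ => x ^ 2) (2 * x) x := by simpa using hasDerivAt_pow 2 x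
    have hlog : HasDerivAt (fun x => Real.log (x / a)) ((1 / a) / (x / a)) x :=
      ((hasDerivAt_id x).div_const a).log hxa
    have h := ((h1.const_mul K).div_const 2).add ((h1.div_const 2).mul hlog) |>.sub (h1.div_const 4)
    refine h.congr_deriv ?_
    field_simp
    ring
  have hΦc : ContinuousOn (fun x => K * x ^ 2 / 2 + x ^ 2 / 2 * Real.log (x / a) - x ^ 2 / 4) (Icc a r) := by
    have hl : ContinuousOn (fun x => Real.log (x / a)) (Icc a r) :=
      ContinuousOn.log (continuousOn_id.div_const a) fun x hx => div_ne_zero (ha.trans_le hx.1).ne' ha.ne'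
    exact (((continuousOn_const.mul (continuousOn_id.pow 2)).div_const 2).add
      (((continuousOn_id.pow 2).div_const 2).mul hl)).sub ((continuousOn_id.pow 2).div_const 4)
  have hint : IntervalIntegrable (fun x => x * (K + Real.log (x / a))) volume a r := by
    refine ContinuousOn.intervalIntegrable ?_
    rw [uIcc_of_le har]
    exact continuousOn_id.mul (continuousOn_const.add
      (ContinuousOn.log (continuousOn_id.div_const a) fun x hx => div_ne_zero (ha.trans_le hx.1).ne' ha.ne'))
  have hFTC := intervalIntegral.integral_eq_sub_of_hasDerivAt_of_le har hΦc hΦd hint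
  unfold psiBar1
  rw [intervalIntegral.integral_congr hin, hFTC, hvac r har, div_self ha.ne', Real.log_one]
  have hr0 : r ≠ 0 := hr.ne'
  field_simp
  ring

/-- **SHAFRANOV'S VERTICAL FIELD BY MATCHING ((6.89) = (6.82)).**  Same data, `B_θa = μ₀I/(2πa)`
(`hI`), `R₀ > 0`: as `r → ∞`, `[ψ̄₁(r) − ψ̄₁^far(r)]/r → (μ₀I/4π)(β_p + (l_i − 3)/2 + ln(8R₀/a)) − R₀ B_V`;
in particular the plasma solution (6.88) matches the wire-plus-vertical-field far field (6.82) to `o(r)`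
IF AND ONLY IF `B_V = (μ₀I/4πR₀)(β_p + (l_i − 3)/2 + ln 8R₀/a)` (`psiBar1_matches_iff`).
[cite: Freidberg2014, §6.4.6 eqs. (6.82), (6.89), (6.90)] -/
theorem tendsto_psiBar1_matching {a R₀ I BV : ℝ} (ha : 0 < a) (hR : 0 < R₀) (hBa : P.Bθ a ≠ 0)
    (hI : P.μ₀ * I = 2 * π * a * P.Bθ a)
    (hBθc : ContinuousOn P.Bθ (Icc 0 a))
    (hpc : ContinuousOn P.p (Icc 0 a)) (hpd : ∀ y ∈ Ioo 0 a, DifferentiableAt ℝ P.p y)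
    (hpi : IntervalIntegrable (fun y => y ^ 2 * deriv P.p y) volume 0 a) (hpa : P.p a = 0)
    (hvac : ∀ y, a ≤ y → P.Bθ y = P.Bθ a * a / y) (hp0 : ∀ y, a < y → deriv P.p y = 0) :
    Tendsto (fun r => (P.psiBar1 a r - psiBar1Far P.μ₀ I R₀ BV r) / r) atTop
      (𝓝 (P.μ₀ * I / (4 * π) * (P.rfpBetaP a + (P.internalInductance a - 3) / 2 + Real.log (8 * R₀ / a))
        - R₀ * BV)) := by
  set K := P.rfpBetaP a + P.internalInductance a / 2 with hK
  have hπ : (π : ℝ) ≠ 0 := Real.pi_ne_zero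
  have hC : P.μ₀ * I / (4 * π) = a * P.Bθ a / 2 := by
    field_simp
    linarith [hI]
  -- eventually (for `r ≥ a`) the quotient is `L − (aB_θa/2)(K − 1/2) a² (r²)⁻¹`
  have hev : ∀ᶠ r in atTop, (P.psiBar1 a r - psiBar1Far P.μ₀ I R₀ BV r) / r
      = (a * P.Bθ a / 2 * (K - 3 / 2 + Real.log (8 * R₀ / a)) - R₀ * BV)
        - a * P.Bθ a / 2 * (K - 1 / 2) * a ^ 2 * (r ^ 2)⁻¹ := by
    filter_upwards [eventually_ge_atTop a] with r har
    have hr : 0 < r := lt_of_lt_of_le ha har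
    rw [P.psiBar1_outer ha har hBa hBθc hpc hpd hpi hpa hvac hp0]
    unfold psiBar1Far
    rw [hC]
    have hl1 : Real.log (r / a) = Real.log r - Real.log a := Real.log_div hr.ne' ha.ne'
    have hl2 : Real.log (8 * R₀ / r) = Real.log (8 * R₀) - Real.log r := Real.log_div (by positivity) hr.ne'
    have hl3 : Real.log (8 * R₀ / a) = Real.log (8 * R₀) - Real.log a := Real.log_div (by positivity) ha.ne'
    rw [hl1, hl2, hl3, ← hK]
    have hr0 : r ≠ 0 := hr.ne'
    field_simp
    ring
  have hlim : Tendsto (fun r : ℝ => (a * P.Bθ a / 2 * (K - 3 / 2 + Real.log (8 * R₀ / a)) - R₀ * BV)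
      - a * P.Bθ a / 2 * (K - 1 / 2) * a ^ 2 * (r ^ 2)⁻¹) atTop
      (𝓝 ((a * P.Bθ a / 2 * (K - 3 / 2 + Real.log (8 * R₀ / a)) - R₀ * BV)
        - a * P.Bθ a / 2 * (K - 1 / 2) * a ^ 2 * 0)) := by
    have h2 : Tendsto (fun r : ℝ => (r ^ 2)⁻¹) atTop (𝓝 0) :=
      tendsto_inv_atTop_zero.comp (tendsto_pow_atTop two_ne_zero)
    exact tendsto_const_nhds.sub (tendsto_const_nhds.mul h2)
  rw [mul_zero, sub_zero] at hlim
  have e : a * P.Bθ a / 2 * (K - 3 / 2 + Real.log (8 * R₀ / a)) - R₀ * BV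
      = P.μ₀ * I / (4 * π) * (P.rfpBetaP a + (P.internalInductance a - 3) / 2 + Real.log (8 * R₀ / a))
        - R₀ * BV := by
    rw [hC, hK]; ring
  rw [← e]
  exact hlim.congr' (EventuallyEq.symm hev)

/-- **… IFF `B_V` IS SHAFRANOV'S (6.90).**  Same data: the plasma solution matches the far field to `o(r)`,
`[ψ̄₁(r) − ψ̄₁^far(r)]/r → 0`, if and only if `B_V = (μ₀I/4πR₀)(β_p + (l_i − 3)/2 + ln 8R₀/a)`
(`shafranovVerticalField`) — «This well-known and often used result was first derived by Shafranov (1966)».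
[cite: Freidberg2014, §6.4.6 eqs. (6.89)–(6.90)] -/
theorem psiBar1_matches_iff {a R₀ I BV : ℝ} (ha : 0 < a) (hR : 0 < R₀) (hBa : P.Bθ a ≠ 0)
    (hI : P.μ₀ * I = 2 * π * a * P.Bθ a)
    (hBθc : ContinuousOn P.Bθ (Icc 0 a))
    (hpc : ContinuousOn P.p (Icc 0 a)) (hpd : ∀ y ∈ Ioo 0 a, DifferentiableAt ℝ P.p y)
    (hpi : IntervalIntegrable (fun y => y ^ 2 * deriv P.p y) volume 0 a) (hpa : P.p a = 0)
    (hvac : ∀ y, a ≤ y → P.Bθ y = P.Bθ a * a / y) (hp0 : ∀ y, a < y → deriv P.p y = 0) :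
    Tendsto (fun r => (P.psiBar1 a r - psiBar1Far P.μ₀ I R₀ BV r) / r) atTop (𝓝 0) ↔
      BV = shafranovVerticalField P.μ₀ I R₀ a (P.rfpBetaP a) (P.internalInductance a) := by
  have h := P.tendsto_psiBar1_matching (BV := BV) ha hR hBa hI hBθc hpc hpd hpi hpa hvac hp0
  have key : P.μ₀ * I / (4 * π) * (P.rfpBetaP a + (P.internalInductance a - 3) / 2 + Real.log (8 * R₀ / a))
      - R₀ * BV = 0 ↔ BV = shafranovVerticalField P.μ₀ I R₀ a (P.rfpBetaP a) (P.internalInductance a) := by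
    unfold shafranovVerticalField
    set T := P.rfpBetaP a + (P.internalInductance a - 3) / 2 + Real.log (8 * R₀ / a) with hT
    have hR0 : R₀ ≠ 0 := hR.ne'
    have hπ : (π : ℝ) ≠ 0 := Real.pi_ne_zero
    have e : P.μ₀ * I / (4 * π * R₀) * T = (P.μ₀ * I / (4 * π) * T) / R₀ := by
      field_simp
    rw [e, eq_div_iff hR0]
    constructor
    · intro h0; linarith
    · intro h0; linarith
  constructor
  · intro h0
    exact key.1 (tendsto_nhds_unique h h0)
  · intro hBV
    rwa [key.2 hBV] at h

/-! ## §4 Worked check (non-vacuity): uniform current density and zero pressure gradient -/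

/-- UNIFORM CURRENT (`B_θ = c r`), FLAT PRESSURE: the square bracket is `c² x⁴/4`. [folklore]
[cite: Freidberg2014, §6.4.4 eq. (6.66)] -/
theorem torBracket_of_linear {c : ℝ} (hB : ∀ r, P.Bθ r = c * r) (hp : ∀ r, deriv P.p r = 0) (x : ℝ) :
    P.torBracket x = c ^ 2 * x ^ 4 / 4 := by
  unfold torBracket
  have e : (fun y => y * P.Bθ y ^ 2 - 2 * P.μ₀ * y ^ 2 * deriv P.p y) = fun y => c ^ 2 * y ^ 3 := by
    funext y
    rw [hB, hp]
    ring
  rw [e, intervalIntegral.integral_const_mul, integral_pow]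
  ring

/-- UNIFORM CURRENT: `l_i = 1/2` (the textbook value for a flat current profile). [folklore]
[cite: Freidberg2014, §6.4.6 eq. (6.86)] -/
theorem internalInductance_of_linear {c a : ℝ} (hc : c ≠ 0) (ha : a ≠ 0) (hB : ∀ r, P.Bθ r = c * r) :
    P.internalInductance a = 1 / 2 := by
  unfold internalInductance areaAvg
  have e : (fun r => P.Bθ r ^ 2 * r) = fun r => c ^ 2 * r ^ 3 := by
    funext r
    rw [hB]
    ring
  rw [e, intervalIntegral.integral_const_mul, integral_pow, hB]
  field_simp
  ring

/-- UNIFORM CURRENT, FLAT PRESSURE: the shift is the parabola `Δ(r) = (a² − r²)/(8R₀)` — at the axis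
`Δ(0⁺) → a²/(8R₀) = (a²/2R₀)(β_p + l_i/2)` with `β_p = 0`, `l_i = 1/2`. [folklore]
[cite: Freidberg2014, §6.4.4 eq. (6.72)] -/
theorem fluxShift_of_linear {c R₀ a r : ℝ} (hc : c ≠ 0) (hR : R₀ ≠ 0) (hr : 0 < r) (hra : r ≤ a)
    (hB : ∀ r, P.Bθ r = c * r) (hp : ∀ r, deriv P.p r = 0) :
    P.fluxShift R₀ a r = (a ^ 2 - r ^ 2) / (8 * R₀) := by
  rw [P.fluxShift_eq_integral hR (by rw [hB]; exact mul_ne_zero hc hr.ne')]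
  have e : ∀ x ∈ uIcc r a, P.torBracket x / (x * P.Bθ x ^ 2) = 1 / 4 * x := by
    intro x hx
    rw [uIcc_of_le hra] at hx
    have hx0 : x ≠ 0 := (hr.trans_le hx.1).ne'
    rw [P.torBracket_of_linear hB hp, hB]
    field_simp
  rw [intervalIntegral.integral_congr e, intervalIntegral.integral_const_mul, integral_id]
  field_simp
  ring

/-! ## §5 Freidberg's model RFP profiles (5.42)–(5.47) = (6.74) — BY NAME on `RFPModelEquilibrium.lean`
(`RFP.presN`, `RFP.bθSqN`, `RFP.profile`): the bracket and the axis-shift integrand (6.75) in closed form -/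

/-- THE SQUARE BRACKET OF (6.66) FOR THE RFP MODEL PROFILES (6.74), normalised («The y integration can be
carried out analytically»): `∫_0^x [yB_θ² − 2μ₀y²p′] dy = a²B_z0² · G(x/a)` with
`G(s) = α_p(35s⁸/8 − 100s¹⁴/21 + 49s²⁰/30) + α_z(s⁴/2 − 2(2α_z+1)s⁶/9 + 3α_z s⁸/8 − 2α_z s¹⁰/25)`.
[cite: Freidberg2014, §6.4.5 eqs. (6.73)–(6.75)] -/
def rfpBracketHat (αp αz s : ℝ) : ℝ :=
  αp * (35 / 8 * s ^ 8 - 100 / 21 * s ^ 14 + 49 / 30 * s ^ 20)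
    + αz * (s ^ 4 / 2 - 2 * (2 * αz + 1) / 9 * s ^ 6 + 3 * αz / 8 * s ^ 8 - 2 * αz / 25 * s ^ 10)

/-- THE FUNCTION `g(x, α_p, α_z)` OF THE AXIS-SHIFT INTEGRAND (6.75), `Δ₀/a = (a/R₀)∫₀¹ x³ g/(B_θ²/B_z0²) dx`,
as it follows from (6.73)–(6.74) (`g = G/x⁴`):
`g = α_p(35x⁴/8 − 100x¹⁰/21 + 49x¹⁶/30) + (α_z/2)[1 − (4/9)(2α_z+1)x² + (3/4)α_z x⁴ − (4/25)α_z x⁶]`.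
TRANSCRIPTION NOTE: the `α_z`-part is the printed one verbatim; for the `α_p`-part our OCR of the printed page
reads «`(α_p/3)(109x⁴ − 200x¹⁰ + 98x¹⁶)`», which is NOT what (6.73)–(6.74) give (the derived numerators over
`24, 42, 60` are `105, 200, 98`: `35/8 = 105/24`, `100/21 = 200/42`, `49/30 = 98/60`) — to be compared with the
printed page by a reader holding the book; the kernel statements below use the DERIVED form only.
[cite: Freidberg2014, §6.4.5 eq. (6.75)] -/
def rfpAxisShiftG (αp αz x : ℝ) : ℝ :=
  αp * (35 / 8 * x ^ 4 - 100 / 21 * x ^ 10 + 49 / 30 * x ^ 16)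
    + αz / 2 * (1 - 4 / 9 * (2 * αz + 1) * x ^ 2 + 3 / 4 * αz * x ^ 4 - 4 / 25 * αz * x ^ 6)

/-- `G(s) = s⁴ g(s)`. [cite: Freidberg2014, §6.4.5 eq. (6.75)] -/
theorem rfpBracketHat_eq (αp αz s : ℝ) : rfpBracketHat αp αz s = s ^ 4 * rfpAxisShiftG αp αz s := by
  unfold rfpBracketHat rfpAxisShiftG
  ring

/-- `G′(s) = s·(B_θ²/B_z0²)(s) − s²·(2μ₀p/B_z0²)′(s)` with the printed (5.47) `RFP.bθSqN` and the printed pressure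
derivative `RFP.dpresN` — the normalised integrand of the bracket. [cite: Freidberg2014, §6.4.5 eqs. (6.73)–(6.74)] -/
theorem hasDerivAt_rfpBracketHat (αp αz s : ℝ) :
    HasDerivAt (rfpBracketHat αp αz) (s * RFP.bθSqN αp αz s - s ^ 2 * RFP.dpresN αp s) s := by
  unfold rfpBracketHat RFP.bθSqN RFP.dpresN
  have h := ((((hasDerivAt_pow 8 s).const_mul (35 / 8 : ℝ)).sub ((hasDerivAt_pow 14 s).const_mul (100 / 21 : ℝ))).add
    ((hasDerivAt_pow 20 s).const_mul (49 / 30 : ℝ))).const_mul αp |>.add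
    (((((hasDerivAt_pow 4 s).div_const 2).sub ((hasDerivAt_pow 6 s).const_mul (2 * (2 * αz + 1) / 9))).add
      ((hasDerivAt_pow 8 s).const_mul (3 * αz / 8))).sub ((hasDerivAt_pow 10 s).const_mul (2 * αz / 25))
      |>.const_mul αz)
  refine (h.congr_of_eventuallyEq (Filter.Eventually.of_forall fun x => ?_)).congr_deriv ?_
  · simp only [Pi.add_apply, Pi.sub_apply]
  · push_cast
    ring

/-- **THE BRACKET OF THE MODEL RFP EQUILIBRIUM IN CLOSED FORM.**  For the tree's model profile
`RFP.profile μ₀ B_z0 a α_p α_z` ((5.42)/(5.44)/(5.47) = (6.74)) with `μ₀ ≠ 0`, `a > 0` and the printed parameter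
range `0 ≤ α_p`, `0 ≤ α_z ≤ 10/7` (so that `B_θ² = B_z0²·(5.47)` on `[0, a]`): for `0 ≤ x ≤ a`,
`∫_0^x [yB_θ² − 2μ₀y²p′] dy = a² B_z0² G(x/a)` («The y integration can be carried out analytically»).
[cite: Freidberg2014, §6.4.5 eqs. (6.73)–(6.75)] -/
theorem torBracket_rfpProfile {μ₀ Bz0 a αp αz x : ℝ} (hμ : μ₀ ≠ 0) (ha : 0 < a) (hαp : 0 ≤ αp) (hαz : 0 ≤ αz)
    (hαz' : αz ≤ 10 / 7) (hx0 : 0 ≤ x) (hxa : x ≤ a) :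
    (RFP.profile μ₀ Bz0 a αp αz).torBracket x = a ^ 2 * Bz0 ^ 2 * rfpBracketHat αp αz (x / a) := by
  set Q := RFP.profile μ₀ Bz0 a αp αz with hQ
  -- on `[0, a]`: `B_θ² = B_z0²·bθSqN(y/a)` and `p′ = (B_z0²/2μ₀)·dpresN(y/a)/a`
  have hBsq : ∀ y ∈ Icc 0 a, Q.Bθ y ^ 2 = Bz0 ^ 2 * RFP.bθSqN αp αz (y / a) := fun y hy =>
    RFP.profile_Bθ_sq (RFP.bθSqN_nonneg hαp hαz hαz'
      ⟨div_nonneg hy.1 ha.le, (div_le_one ha).mpr hy.2⟩)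
  have hpd : ∀ y, deriv Q.p y = Bz0 ^ 2 / (2 * μ₀) * (RFP.dpresN αp (y / a) / a) := fun y =>
    (RFP.hasDerivAt_profile_p ha.ne' y).deriv
  have hμQ : Q.μ₀ = μ₀ := RFP.profile_μ₀
  -- the integrand equals `a B_z0² G′(y/a)·(1/a)·a`, pointwise on `[0, a]`
  have hpt : ∀ y ∈ Icc 0 a, y * Q.Bθ y ^ 2 - 2 * Q.μ₀ * y ^ 2 * deriv Q.p y
      = a ^ 2 * Bz0 ^ 2 * ((y / a * RFP.bθSqN αp αz (y / a) - (y / a) ^ 2 * RFP.dpresN αp (y / a)) * (1 / a)) := by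
    intro y hy
    rw [hBsq y hy, hpd y, hμQ]
    field_simp
  -- the closed form `F(y) = a² B_z0² G(y/a)` has derivative = the bracket integrand on `(0, x)`
  have hFd : ∀ y ∈ Ioo 0 x, HasDerivAt (fun y => a ^ 2 * Bz0 ^ 2 * rfpBracketHat αp αz (y / a))
      (y * Q.Bθ y ^ 2 - 2 * Q.μ₀ * y ^ 2 * deriv Q.p y) y := by
    intro y hy
    have h1 : HasDerivAt (fun r : ℝ => r / a) (1 / a) y := (hasDerivAt_id y).div_const a
    have h := ((hasDerivAt_rfpBracketHat αp αz (y / a)).comp y h1).const_mul (a ^ 2 * Bz0 ^ 2)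
    rw [hpt y ⟨hy.1.le, hy.2.le.trans hxa⟩]
    exact h
  have hFc : ContinuousOn (fun y => a ^ 2 * Bz0 ^ 2 * rfpBracketHat αp αz (y / a)) (Icc 0 x) := by
    refine Continuous.continuousOn ?_
    unfold rfpBracketHat
    fun_prop
  have hint : IntervalIntegrable (fun y => y * Q.Bθ y ^ 2 - 2 * Q.μ₀ * y ^ 2 * deriv Q.p y) volume 0 x := by
    have hcont : ContinuousOn (fun y => a ^ 2 * Bz0 ^ 2 *
        ((y / a * RFP.bθSqN αp αz (y / a) - (y / a) ^ 2 * RFP.dpresN αp (y / a)) * (1 / a))) (uIcc 0 x) := by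
      refine Continuous.continuousOn ?_
      unfold RFP.bθSqN RFP.dpresN
      fun_prop
    refine (hcont.intervalIntegrable).congr ?_
    rw [uIoc_of_le hx0]
    intro y hy
    exact (hpt y ⟨hy.1.le, hy.2.trans hxa⟩).symm
  unfold torBracket
  rw [intervalIntegral.integral_eq_sub_of_hasDerivAt_of_le hx0 hFc hFd hint]
  unfold rfpBracketHat
  simp

/-- **THE AXIS-SHIFT INTEGRAND (6.75) FOR THE MODEL RFP EQUILIBRIUM.**  Same data; at a point `0 < x ≤ a` where
the printed `B_θ²/B_z0²` (5.47) is positive and `B_z0 ≠ 0`: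
`bracket(x)/(x B_θ(x)²) = a · (x/a)³ g(x/a, α_p, α_z)/(B_θ²/B_z0²)(x/a)` (see the TRANSCRIPTION NOTE on
`rfpAxisShiftG`). [cite: Freidberg2014, §6.4.5 eq. (6.75)] -/
theorem axisShiftIntegrand_rfpProfile {μ₀ Bz0 a αp αz x : ℝ} (hμ : μ₀ ≠ 0) (ha : 0 < a) (hBz : Bz0 ≠ 0)
    (hαp : 0 ≤ αp) (hαz : 0 ≤ αz) (hαz' : αz ≤ 10 / 7) (hx0 : 0 < x) (hxa : x ≤ a)
    (hb : 0 < RFP.bθSqN αp αz (x / a)) :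
    (RFP.profile μ₀ Bz0 a αp αz).torBracket x / (x * (RFP.profile μ₀ Bz0 a αp αz).Bθ x ^ 2)
      = a * ((x / a) ^ 3 * rfpAxisShiftG αp αz (x / a) / RFP.bθSqN αp αz (x / a)) := by
  rw [torBracket_rfpProfile hμ ha hαp hαz hαz' hx0.le hxa, rfpBracketHat_eq, RFP.profile_Bθ_sq hb.le]
  have hx : x ≠ 0 := hx0.ne'
  have hb' : RFP.bθSqN αp αz (x / a) ≠ 0 := hb.ne'
  field_simp

/-- The printed `B_θ²/B_z0²` (5.47) is positive on `(0, a]` in the operating range `0 ≤ α_p`, `0 < α_z ≤ 10/7`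
with a non-degenerate edge `α_p + α_z(10 − 7α_z)/15 > 0` ((5.51): `= B_θa²/B_z0²`) — BY NAME on `RFP.bθSqN_pos`,
`RFP.bθSqN_one`. [cite: Freidberg2014, §5.5.1 eqs. (5.47), (5.51)] -/
theorem rfp_bθSqN_pos_Ioc {a αp αz x : ℝ} (ha : 0 < a) (hαp : 0 ≤ αp) (hαz : 0 < αz) (hαz' : αz ≤ 10 / 7)
    (hedge : 0 < αp + αz * (10 - 7 * αz) / 15) (hx : x ∈ Ioc 0 a) : 0 < RFP.bθSqN αp αz (x / a) := by
  rcases hx.2.lt_or_eq with hlt | heq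
  · exact RFP.bθSqN_pos hαp hαz hαz' ⟨div_pos hx.1 ha, (div_lt_one ha).mpr hlt⟩
  · rw [heq, div_self ha.ne', RFP.bθSqN_one]
    exact hedge

/-- **THE SHAFRANOV SHIFT OF THE MODEL RFP EQUILIBRIUM AS THE PRINTED QUADRATURE (6.75):** for
`RFP.profile μ₀ B_z0 a α_p α_z` in the operating range (`μ₀ ≠ 0`, `B_z0 ≠ 0`, `a > 0`, `0 ≤ α_p`, `0 < α_z ≤ 10/7`,
`α_p + α_z(10 − 7α_z)/15 > 0`) bent into a torus of major radius `R₀ ≠ 0`: for `0 < r ≤ a`,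
`Δ(r) = (a/R₀) ∫_r^a (x/a)³ g(x/a)/(B_θ²/B_z0²)(x/a) dx` — whose `r → 0` limit is Freidberg's `Δ₀/a` (6.75), the
curve of Fig. 6.6 (with the DERIVED `g`). [cite: Freidberg2014, §6.4.5 eq. (6.75)] -/
theorem fluxShift_rfpProfile {μ₀ Bz0 a αp αz R₀ r : ℝ} (hR : R₀ ≠ 0) (hμ : μ₀ ≠ 0) (hBz : Bz0 ≠ 0) (ha : 0 < a)
    (hαp : 0 ≤ αp) (hαz : 0 < αz) (hαz' : αz ≤ 10 / 7) (hedge : 0 < αp + αz * (10 - 7 * αz) / 15)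
    (hr : 0 < r) (hra : r ≤ a) :
    (RFP.profile μ₀ Bz0 a αp αz).fluxShift R₀ a r
      = a / R₀ * ∫ x in r..a, (x / a) ^ 3 * rfpAxisShiftG αp αz (x / a) / RFP.bθSqN αp αz (x / a) := by
  have hBθ : ∀ x ∈ Ioc 0 a, (RFP.profile μ₀ Bz0 a αp αz).Bθ x ≠ 0 := by
    intro x hx h0
    have hb := rfp_bθSqN_pos_Ioc ha hαp hαz hαz' hedge hx
    have hsq := RFP.profile_Bθ_sq (μ₀ := μ₀) (Bz0 := Bz0) hb.le
    rw [h0] at hsq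
    have : Bz0 ^ 2 * RFP.bθSqN αp αz (x / a) = 0 := by rw [← hsq]; ring
    rcases mul_eq_zero.mp this with h | h
    · exact hBz (pow_eq_zero_iff two_ne_zero |>.mp h)
    · exact hb.ne' h
  rw [fluxShift_eq_integral _ hR (hBθ r ⟨hr, hra⟩), ← intervalIntegral.integral_const_mul,
    ← intervalIntegral.integral_const_mul]
  refine intervalIntegral.integral_congr fun x hx => ?_
  rw [uIcc_of_le hra] at hx
  have hx0 : 0 < x := hr.trans_le hx.1
  rw [axisShiftIntegrand_rfpProfile hμ ha hBz hαp hαz.le hαz' hx0 hx.2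
    (rfp_bθSqN_pos_Ioc ha hαp hαz hαz' hedge ⟨hx0, hx.2⟩)]
  field_simp

/-- THE REGULAR FORM OF THE (6.75) INTEGRAND: with `B_θ²/B_z0² = ρ²·bθSlopeSq(ρ)` (`RFP.bθSqN_eq_sq_mul`,
`bθSlopeSq(0) = 2α_z`) the integrand `x³g/(B_θ²/B_z0²)` IS `x·g/bθSlopeSq` — no removable singularity at the axis
(both sides read with Lean's `·/0 = 0`). [cite: Freidberg2014, §6.4.5 eq. (6.75); §5.5.1 eq. (5.47)] -/
theorem rfpAxisShiftIntegrand_eq (αp αz s : ℝ) :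
    s ^ 3 * rfpAxisShiftG αp αz s / RFP.bθSqN αp αz s = s * rfpAxisShiftG αp αz s / RFP.bθSlopeSq αp αz s := by
  rw [RFP.bθSqN_eq_sq_mul]
  by_cases hs : s = 0
  · subst hs
    simp
  · by_cases hq : RFP.bθSlopeSq αp αz s = 0
    · rw [hq]
      simp
    · field_simp

/-- `bθSlopeSq > 0` on `[0, a]` in the operating range (interior and edge from `rfp_bθSqN_pos_Ioc`, the axis value
`2α_z`). [cite: Freidberg2014, §5.5.1 eq. (5.47); §11.7.7 eq. (11.286)] -/
theorem rfp_bθSlopeSq_pos_Icc {a αp αz x : ℝ} (ha : 0 < a) (hαp : 0 ≤ αp) (hαz : 0 < αz) (hαz' : αz ≤ 10 / 7)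
    (hedge : 0 < αp + αz * (10 - 7 * αz) / 15) (hx : x ∈ Icc 0 a) : 0 < RFP.bθSlopeSq αp αz (x / a) := by
  rcases hx.1.lt_or_eq with hpos | h0
  · have hb := rfp_bθSqN_pos_Ioc ha hαp hαz hαz' hedge ⟨hpos, hx.2⟩
    rw [RFP.bθSqN_eq_sq_mul] at hb
    exact pos_of_mul_pos_right hb (sq_nonneg _)
  · rw [← h0, zero_div, RFP.bθSlopeSq_zero]
    linarith

/-- **THE SHIFT OF THE MODEL RFP EQUILIBRIUM, REGULAR FORM:** on the operating range, for `0 < r ≤ a`,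
`Δ(r) = (a/R₀)∫_r^a (x/a)·g(x/a)/bθSlopeSq(x/a) dx` with a integrand continuous on `[0, a]`.
[cite: Freidberg2014, §6.4.5 eq. (6.75)] -/
theorem fluxShift_rfpProfile' {μ₀ Bz0 a αp αz R₀ r : ℝ} (hR : R₀ ≠ 0) (hμ : μ₀ ≠ 0) (hBz : Bz0 ≠ 0) (ha : 0 < a)
    (hαp : 0 ≤ αp) (hαz : 0 < αz) (hαz' : αz ≤ 10 / 7) (hedge : 0 < αp + αz * (10 - 7 * αz) / 15)
    (hr : 0 < r) (hra : r ≤ a) :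
    (RFP.profile μ₀ Bz0 a αp αz).fluxShift R₀ a r
      = a / R₀ * ∫ x in r..a, x / a * rfpAxisShiftG αp αz (x / a) / RFP.bθSlopeSq αp αz (x / a) := by
  rw [fluxShift_rfpProfile hR hμ hBz ha hαp hαz hαz' hedge hr hra]
  congr 1
  exact intervalIntegral.integral_congr fun x _ => rfpAxisShiftIntegrand_eq αp αz (x / a)

/-- **THE AXIS SHIFT `Δ₀` OF THE MODEL RFP EQUILIBRIUM = FREIDBERG'S QUADRATURE (6.75):** on the operating range,
`Δ(r) → Δ₀ := (a/R₀)∫_0^a (x/a)·g(x/a)/bθSlopeSq(x/a) dx` as `r → 0⁺`, i.e. `Δ₀/a = (a/R₀)∫₀¹ s³g/(B_θ²/B_z0²) ds`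
(the curve of Fig. 6.6 at `α_z = 1.1`, `R₀/a = 5`, with the DERIVED `g`; its certified values are a producer's
quadrature). [cite: Freidberg2014, §6.4.5 eq. (6.75), Fig. 6.6] -/
theorem tendsto_fluxShift_rfpProfile_axis {μ₀ Bz0 a αp αz R₀ : ℝ} (hR : R₀ ≠ 0) (hμ : μ₀ ≠ 0) (hBz : Bz0 ≠ 0)
    (ha : 0 < a) (hαp : 0 ≤ αp) (hαz : 0 < αz) (hαz' : αz ≤ 10 / 7) (hedge : 0 < αp + αz * (10 - 7 * αz) / 15) :
    Tendsto (fun r => (RFP.profile μ₀ Bz0 a αp αz).fluxShift R₀ a r) (𝓝[>] 0)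
      (𝓝 (a / R₀ * ∫ x in (0:ℝ)..a, x / a * rfpAxisShiftG αp αz (x / a) / RFP.bθSlopeSq αp αz (x / a))) := by
  set h : ℝ → ℝ := fun x => x / a * rfpAxisShiftG αp αz (x / a) / RFP.bθSlopeSq αp αz (x / a) with hh
  -- `h` is continuous on `[0, a]`
  have hc : ContinuousOn h (uIcc 0 a) := by
    rw [uIcc_of_le ha.le]
    refine ContinuousOn.div ?_ ?_ fun x hx => (rfp_bθSlopeSq_pos_Icc ha hαp hαz hαz' hedge hx).ne'
    · refine Continuous.continuousOn ?_
      unfold rfpAxisShiftG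
      fun_prop
    · refine Continuous.continuousOn ?_
      unfold RFP.bθSlopeSq
      fun_prop
  -- the primitive `r ↦ ∫_a^r h` is continuous on `[0, a]`
  have hprim : ContinuousOn (fun r => ∫ x in a..r, h x) (uIcc 0 a) :=
    intervalIntegral.continuousOn_primitive_interval' hc.intervalIntegrable
      (by rw [uIcc_of_le ha.le]; exact ⟨ha.le, le_rfl⟩)
  have hΦ : ContinuousOn (fun r => a / R₀ * -∫ x in a..r, h x) (uIcc 0 a) :=
    (hprim.neg).const_smul (a / R₀) |>.congr fun r _ => by simp [smul_eq_mul]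
  have h0 : (0:ℝ) ∈ uIcc 0 a := by rw [uIcc_of_le ha.le]; exact ⟨le_rfl, ha.le⟩
  have hT := (hΦ 0 h0).tendsto
  rw [intervalIntegral.integral_symm 0 a, neg_neg] at hT
  -- restrict to `r → 0⁺` and replace the primitive by `Δ(r)` on `(0, a)`
  have hle : 𝓝[>] (0:ℝ) ≤ 𝓝[uIcc 0 a] 0 := by
    rw [← nhdsWithin_Ioo_eq_nhdsGT ha, uIcc_of_le ha.le]
    exact nhdsWithin_mono _ Ioo_subset_Icc_self
  refine (hT.mono_left hle).congr' ?_
  rw [← nhdsWithin_Ioo_eq_nhdsGT ha]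
  filter_upwards [self_mem_nhdsWithin] with r hr
  rw [fluxShift_rfpProfile' hR hμ hBz ha hαp hαz hαz' hedge hr.1 hr.2.le, intervalIntegral.integral_symm r a,
    neg_neg]


/-- `∫₀¹ ρ·(B_θ²/B_z0²) dρ` for the printed (5.47) in closed form:
`= (69/280)α_p + α_z(5/18 − 269α_z/1800)` (polynomial integration). [cite: Freidberg2014, §5.5.1 eq. (5.47); §6.4.6 eq. (6.86)] -/
theorem integral_mul_rfp_bθSqN (αp αz : ℝ) :
    ∫ s in (0:ℝ)..1, s * RFP.bθSqN αp αz s = 69 / 280 * αp + αz * (5 / 18 - 269 / 1800 * αz) := by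
  have hF : ∀ s ∈ Ioo (0:ℝ) 1, HasDerivAt (fun s : ℝ =>
      αp / 9 * (35 / 8 * s ^ 8 - 20 / 7 * s ^ 14 + 7 / 10 * s ^ 20)
        + αz / 15 * (15 / 2 * s ^ 4 - 10 * (2 * αz + 1) / 3 * s ^ 6 + 45 * αz / 8 * s ^ 8 - 6 * αz / 5 * s ^ 10))
      (s * RFP.bθSqN αp αz s) s := by
    intro s _
    unfold RFP.bθSqN
    have h := ((((hasDerivAt_pow 8 s).const_mul (35 / 8 : ℝ)).sub ((hasDerivAt_pow 14 s).const_mul (20 / 7 : ℝ))).add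
      ((hasDerivAt_pow 20 s).const_mul (7 / 10 : ℝ))).const_mul (αp / 9) |>.add
      (((((hasDerivAt_pow 4 s).const_mul (15 / 2 : ℝ)).sub ((hasDerivAt_pow 6 s).const_mul (10 * (2 * αz + 1) / 3))).add
        ((hasDerivAt_pow 8 s).const_mul (45 * αz / 8))).sub ((hasDerivAt_pow 10 s).const_mul (6 * αz / 5))
        |>.const_mul (αz / 15))
    refine (h.congr_of_eventuallyEq (Filter.Eventually.of_forall fun x => ?_)).congr_deriv ?_
    · simp only [Pi.add_apply, Pi.sub_apply]
    · push_cast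
      ring
  have hc : ContinuousOn (fun s : ℝ =>
      αp / 9 * (35 / 8 * s ^ 8 - 20 / 7 * s ^ 14 + 7 / 10 * s ^ 20)
        + αz / 15 * (15 / 2 * s ^ 4 - 10 * (2 * αz + 1) / 3 * s ^ 6 + 45 * αz / 8 * s ^ 8 - 6 * αz / 5 * s ^ 10))
      (Icc 0 1) := Continuous.continuousOn (by fun_prop)
  have hint : IntervalIntegrable (fun s => s * RFP.bθSqN αp αz s) volume 0 1 :=
    Continuous.intervalIntegrable (by unfold RFP.bθSqN; fun_prop) 0 1
  rw [intervalIntegral.integral_eq_sub_of_hasDerivAt_of_le zero_le_one hc hF hint]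
  norm_num
  ring

/-- **THE INTERNAL INDUCTANCE OF THE MODEL RFP EQUILIBRIUM IN CLOSED FORM** ((6.86) on (5.47), `B_θa²/B_z0²` by
(5.51) = `RFP.bθSqN_one`): on `0 ≤ α_p`, `0 ≤ α_z ≤ 10/7` (`B_z0 ≠ 0`; both sides read `·/0 = 0` at a degenerate edge),
`l_i = 2[(69/280)α_p + α_z(5/18 − 269α_z/1800)] / [α_p + α_z(10 − 7α_z)/15]`.
[cite: Freidberg2014, §6.4.6 eq. (6.86); §5.5.1 eqs. (5.47), (5.51)] -/
theorem internalInductance_rfpProfile {μ₀ Bz0 a αp αz : ℝ} (ha : 0 < a) (hBz : Bz0 ≠ 0) (hαp : 0 ≤ αp)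
    (hαz : 0 ≤ αz) (hαz' : αz ≤ 10 / 7) :
    (RFP.profile μ₀ Bz0 a αp αz).internalInductance a
      = 2 * (69 / 280 * αp + αz * (5 / 18 - 269 / 1800 * αz)) / (αp + αz * (10 - 7 * αz) / 15) := by
  unfold internalInductance areaAvg
  have hedge' : (RFP.profile μ₀ Bz0 a αp αz).Bθ a ^ 2 = Bz0 ^ 2 * (αp + αz * (10 - 7 * αz) / 15) := by
    rw [RFP.profile_Bθ_sq (by rw [div_self ha.ne']; exact RFP.bθSqN_nonneg hαp hαz hαz' ⟨zero_le_one, le_rfl⟩),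
      div_self ha.ne', RFP.bθSqN_one]
  have hI : ∫ r in (0:ℝ)..a, (RFP.profile μ₀ Bz0 a αp αz).Bθ r ^ 2 * r
      = a ^ 2 * Bz0 ^ 2 * (69 / 280 * αp + αz * (5 / 18 - 269 / 1800 * αz)) := by
    have e : ∫ r in (0:ℝ)..a, (RFP.profile μ₀ Bz0 a αp αz).Bθ r ^ 2 * r
        = ∫ r in (0:ℝ)..a, a * Bz0 ^ 2 * ((fun s => s * RFP.bθSqN αp αz s) (r / a)) := by
      refine intervalIntegral.integral_congr fun r hr => ?_
      rw [uIcc_of_le ha.le] at hr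
      simp only
      rw [RFP.profile_Bθ_sq (RFP.bθSqN_nonneg hαp hαz hαz' ⟨div_nonneg hr.1 ha.le, (div_le_one ha).mpr hr.2⟩)]
      field_simp
    rw [e, intervalIntegral.integral_const_mul,
      intervalIntegral.integral_comp_div (fun s => s * RFP.bθSqN αp αz s) ha.ne', zero_div,
      div_self ha.ne', integral_mul_rfp_bθSqN, smul_eq_mul]
    ring
  rw [hI, hedge']
  have ha2 : a ^ 2 ≠ 0 := pow_ne_zero 2 ha.ne'
  have hB2 : Bz0 ^ 2 ≠ 0 := pow_ne_zero 2 hBz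
  field_simp

/-- **THE EDGE SLOPE OF THE SHIFT OF THE MODEL RFP EQUILIBRIUM** (left derivative, the model being given on
`[0, a]`): on the operating range, `Δ′(a⁻) = −(a/R₀)(β_p + l_i/2)` with the tree's `rfpBetaP` and
`internalInductance` of the model (closed forms: `RFP.rfpBetaP_profile`, `internalInductance_rfpProfile`).
[cite: Freidberg2014, §6.4.6 eqs. (6.83), (6.86)–(6.88)] -/
theorem hasDerivWithinAt_fluxShift_edge_rfpProfile {μ₀ Bz0 a αp αz R₀ : ℝ} (hR : R₀ ≠ 0)
    (hBz : Bz0 ≠ 0) (ha : 0 < a) (hαp : 0 ≤ αp) (hαz : 0 < αz) (hαz' : αz ≤ 10 / 7)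
    (hedge : 0 < αp + αz * (10 - 7 * αz) / 15) :
    HasDerivWithinAt (fun s => (RFP.profile μ₀ Bz0 a αp αz).fluxShift R₀ a s)
      (-(a / R₀ * ((RFP.profile μ₀ Bz0 a αp αz).rfpBetaP a
        + (RFP.profile μ₀ Bz0 a αp αz).internalInductance a / 2))) (Iic a) a := by
  set Q := RFP.profile μ₀ Bz0 a αp αz with hQ
  have hBθ : ∀ x ∈ Ioc 0 a, Q.Bθ x ≠ 0 := by
    intro x hx h0
    have hb := rfp_bθSqN_pos_Ioc ha hαp hαz hαz' hedge hx
    have hsq := RFP.profile_Bθ_sq (μ₀ := μ₀) (Bz0 := Bz0) hb.le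
    rw [← hQ, h0] at hsq
    have : Bz0 ^ 2 * RFP.bθSqN αp αz (x / a) = 0 := by rw [← hsq]; ring
    rcases mul_eq_zero.mp this with h | h
    · exact hBz (pow_eq_zero_iff two_ne_zero |>.mp h)
    · exact hb.ne' h
  have hBθc : ContinuousOn Q.Bθ (Icc 0 a) := RFP.continuous_profile_Bθ.continuousOn
  have hpd' : ∀ y, deriv Q.p y = Bz0 ^ 2 / (2 * μ₀) * (RFP.dpresN αp (y / a) / a) := fun y =>
    (RFP.hasDerivAt_profile_p ha.ne' y).deriv
  have hg : ContinuousOn (fun y => y * Q.Bθ y ^ 2 - 2 * Q.μ₀ * y ^ 2 * deriv Q.p y) (Icc 0 a) := by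
    have e : (fun y => y * Q.Bθ y ^ 2 - 2 * Q.μ₀ * y ^ 2 * deriv Q.p y)
        = fun y => y * Q.Bθ y ^ 2 - 2 * Q.μ₀ * y ^ 2 * (Bz0 ^ 2 / (2 * μ₀) * (RFP.dpresN αp (y / a) / a)) := by
      funext y; rw [hpd' y]
    rw [e]
    refine Continuous.continuousOn ?_
    have h1 : Continuous Q.Bθ := RFP.continuous_profile_Bθ
    unfold RFP.dpresN
    fun_prop
  have hpc : ContinuousOn Q.p (Icc 0 a) := RFP.continuous_profile_p.continuousOn
  have hpd : ∀ y ∈ Ioo 0 a, DifferentiableAt ℝ Q.p y := fun y _ =>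
    (RFP.hasDerivAt_profile_p ha.ne' y).differentiableAt
  have hpi : IntervalIntegrable (fun y => y ^ 2 * deriv Q.p y) volume 0 a := by
    have e : (fun y => y ^ 2 * deriv Q.p y) = fun y => y ^ 2 * (Bz0 ^ 2 / (2 * μ₀) * (RFP.dpresN αp (y / a) / a)) := by
      funext y; rw [hpd' y]
    rw [e]
    exact Continuous.intervalIntegrable (by unfold RFP.dpresN; fun_prop) 0 a
  have hpa : Q.p a = 0 := RFP.profile_p_edge ha.ne'
  exact Q.hasDerivWithinAt_fluxShift_edge hR ha hBθc hBθ hg hpc hpd hpi hpa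

/-- **EVERY INTERIOR SURFACE OF THE MODEL RFP EQUILIBRIUM IS SHIFTED OUTWARD** on the operating range with
`μ₀ > 0`, `R₀ > 0`: `Δ(r) > 0` for `0 < r < a` (`p′ ≤ 0` from `RFP.dpresN ≤ 0` on `[0, a]`).
[cite: Freidberg2014, §6.4.4 eq. (6.72)] -/
theorem fluxShift_pos_rfpProfile {μ₀ Bz0 a αp αz R₀ r : ℝ} (hR : 0 < R₀) (hμ : 0 < μ₀) (hBz : Bz0 ≠ 0)
    (ha : 0 < a) (hαp : 0 ≤ αp) (hαz : 0 < αz) (hαz' : αz ≤ 10 / 7) (hedge : 0 < αp + αz * (10 - 7 * αz) / 15)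
    (hr : 0 < r) (hra : r < a) :
    0 < (RFP.profile μ₀ Bz0 a αp αz).fluxShift R₀ a r := by
  set Q := RFP.profile μ₀ Bz0 a αp αz with hQ
  have hBθ : ∀ x ∈ Ioc 0 a, Q.Bθ x ≠ 0 := by
    intro x hx h0
    have hb := rfp_bθSqN_pos_Ioc ha hαp hαz hαz' hedge hx
    have hsq := RFP.profile_Bθ_sq (μ₀ := μ₀) (Bz0 := Bz0) hb.le
    rw [← hQ, h0] at hsq
    have : Bz0 ^ 2 * RFP.bθSqN αp αz (x / a) = 0 := by rw [← hsq]; ring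
    rcases mul_eq_zero.mp this with h | h
    · exact hBz (pow_eq_zero_iff two_ne_zero |>.mp h)
    · exact hb.ne' h
  have hBθc : ContinuousOn Q.Bθ (Icc 0 a) := RFP.continuous_profile_Bθ.continuousOn
  have hpd' : ∀ y, deriv Q.p y = Bz0 ^ 2 / (2 * μ₀) * (RFP.dpresN αp (y / a) / a) := fun y =>
    (RFP.hasDerivAt_profile_p ha.ne' y).deriv
  have hg : ContinuousOn (fun y => y * Q.Bθ y ^ 2 - 2 * Q.μ₀ * y ^ 2 * deriv Q.p y) (Icc 0 a) := by
    have e : (fun y => y * Q.Bθ y ^ 2 - 2 * Q.μ₀ * y ^ 2 * deriv Q.p y)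
        = fun y => y * Q.Bθ y ^ 2 - 2 * Q.μ₀ * y ^ 2 * (Bz0 ^ 2 / (2 * μ₀) * (RFP.dpresN αp (y / a) / a)) := by
      funext y; rw [hpd' y]
    rw [e]
    refine Continuous.continuousOn ?_
    have h1 : Continuous Q.Bθ := RFP.continuous_profile_Bθ
    unfold RFP.dpresN
    fun_prop
  have hp' : ∀ y ∈ Ioo 0 a, deriv Q.p y ≤ 0 := by
    intro y hy
    rw [hpd' y]
    unfold RFP.dpresN
    have h1 : 0 ≤ y / a := div_nonneg hy.1.le ha.le
    have h2 : 0 ≤ Bz0 ^ 2 / (2 * μ₀) := div_nonneg (sq_nonneg _) (by linarith)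
    have h3 : -(280 * αp / 9) * (y / a) ^ 5 * (1 - (y / a) ^ 6) ^ 2 / a ≤ 0 := by
      apply div_nonpos_of_nonpos_of_nonneg _ ha.le
      have : 0 ≤ 280 * αp / 9 * (y / a) ^ 5 * (1 - (y / a) ^ 6) ^ 2 := by positivity
      linarith
    exact mul_nonpos_of_nonneg_of_nonpos h2 h3
  have hμQ : 0 ≤ Q.μ₀ := by rw [hQ, RFP.profile_μ₀]; exact hμ.le
  exact Q.fluxShift_pos_of_Icc hR hr hra hμQ hBθc hBθ hp' hg


end ScrewPinch.Profile

end Literature.MathematicalPhysics.MHD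

end
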